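import Literature.NumberTheory.Sieve.BombieriFriedlanderIwaniecLemma6
import Literature.NumberTheory.Sieve.BombieriFriedlanderIwaniecDispersionR1SecondBound
import HarnessLib

/-!
# Bombieri–Friedlander–Iwaniec 1986: Lemma 7 from Lemma 1 (§9, pp. 230–231)

Topic `Literature/NumberTheory/Sieve`.  Everything here is PROVED; no named fact is introduced.
E. Bombieri, J. B. Friedlander, H. Iwaniec, *Primes in arithmetic progressions to large moduli*,
Acta Math. 156 (1986), 203–251, deduce their **Lemma 7** (§9, (9.15), p. 230) — the bound for the
trilinear sum `𝓑_β(C, D, K, H, N)` of (9.14) to which the remainder `ℛ₁` of the dispersion method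
is reduced in §9 ("Estimation of `ℛ₁`. Second method"), and on which **Theorem 2** rests — in one
page (pp. 230–231) from their Lemma 1 (§2, p. 210), which is Deshouillers–Iwaniec, Invent. Math.
70 (1982), Theorem 12 (Kuznetsov's formula and the spectral theory of `Γ₀(rs)∖ℍ`; in neither
Mathlib nor the tree).  This file formalises that page for the sum `BFI.dispBm` of
`…DispersionB` (`𝓑` with the characters modulo `mk`, uniformly in the multiplier `m ≥ 1`; `m = 1`
is the printed `𝓑`), taking Lemma 1 as the hypothesis `BFI.Lemma1BoundFor BFI.plateau2 (5/4)`
of `…Lemma6` exactly as for Lemma 6, Theorem 1 and Theorem 5.  The conclusion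
`BFI.lemma7_dispBm_of_lemma1` has exactly the shape of the hypothesis `h7` of
`BFI.BombieriFriedlanderIwaniecTheorem2_of_lemma7` (`…Theorem2`), so that the named fact
`BombieriFriedlanderIwaniecTheorem2` becomes conditional on Lemma 1 alone
(`BombieriFriedlanderIwaniecTheorem2_of_lemma1`, file `…Theorem2FromLemma1`).

## The proof of Lemma 7 (BFI pp. 230–231), namespace `BFI.L7`

1. "As before it suffices to prove the result for a sum modified by a smooth weight function
   `g(c, d)`": the sharp ranges `c ≤ C`, `d ≤ D` are majorised (all terms of `𝓑_m` being `≥ 0`) by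
   the `O(log C log D)` smooth dyadic plateaus `w(c/2^i) w(d/2^j)` of `…Lemma6`
   (`dispBm_le_sum_blockB`).
2. "Squaring and changing the order of summation we transform `𝓑(C, D, K, H, N)` into
   `𝓚(C, D, |a|KHN, N², 1)`": the character average `φ(mk)⁻¹ ∑_χ χ(n₁)χ̄(n₂)` detects
   `(n₁, mk) = 1 ∧ n₁ ≡ n₂ (mod mk)` (`adm`, `inv_totient_mul_sum_normSq`, using
   `BFI.sum_conj_char_mul_char`), and the phases combine by `BFI.L6.phase_mul_conj`, so that
   `blockB = ∑_{t=(k,h₁,n₁,h₂,n₂) admissible} w_t Inner(ak(h₁n₂−h₂n₁), n₁n₂)` (`blockB_eq_Zpart`), the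
   Kloosterman fraction `e(l (rd)‾/c)` of `𝓚` appearing with `l = ak(h₁n₂−h₂n₁)`, `r = n₁n₂`, `s = 1`.
3. The terms are split by the sign of `l`; `l < 0` is the complex conjugate of `l > 0` (the
   admissibility is swap-invariant, `adm_swap`, `Zpart_neg_eq_conj`), so `blockB ≤ |Z₀| + 2|Z₊|`
   (`blockB_le_parts`).
4. (9.16) "The terms on the diagonal (`l = 0`) are trivially found to contribute
   `≪ (HKN)^ε CDHK ∑|β_n|²`": `|Z₀| ≤ (∑ g) ∑_{t : h₁n₂=h₂n₁} |b_{n₁}||b_{n₂}| ≤ (∑ g) KH(1 + log N) ∑ τ(n) b_n²`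
   by `|b₁||b₂| ≤ (b₁² + b₂²)/2`, the swap symmetry, `BFI.card_diagPairs_le` of `…Lemma6Counting`
   and `∑_{n₂ ≤ N} (n₁,n₂)/max(n₁,n₂) ≤ τ(n₁)(1 + log N)` (`sum_gcd_div_max_le`); `diag_le`.
5. (9.17) "The terms off the diagonal (`l ≠ 0`), by Lemma 1": `Z₊ = ∑_{(l,r)} B(l,r) Inner(l,r)` with the
   coefficients `B_{lr}` of p. 230 (`BcoefB`, `Zpart_pos_eq_sum_BcoefB`); the range `r ≤ N²` is cut
   into dyadic blocks `r ∼ 2^i/2`, on each of which `Z₊` IS a sum `𝓚` at `S = 1/2`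
   (`Zpart_pos_eq_sum_dispK`), bounded by the hypothesis; `𝓘(C,D,|a|KHN,R ≤ N²,1/2)² ≤ 16|a| ·
   [C(N²+HKN)(C+DN²) + C²DN√(N²+HKN) + D²HKN³]` (`lemma1I_sq_le7`).
6. (9.18) "`‖B‖² ≪ (HKN)^ε H²(HK+N) ∑ ϱ(n)|β_n|⁴`": Cauchy–Schwarz over the `≤ τ(l)τ(r)` pairs
   `(k, n₁)` contributing to `B(l,r)` and the count `ν(l;n₁,n₂) ≤ H(n₁,n₂)/max(n₁,n₂) + 1` of
   `…Lemma6Counting` (through `BFI.L6.mu`, `sum_sq_muB_le`), then the count of the admissible `k`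
   (`≤ K` on the diagonal `n₁ = n₂`, `≤ τ(|n₁ − n₂|)` off it, `card_filter_admZ_le`), giving
   `∑|B|² ≤ T_lT_r H² ∑_{n₁,n₂} κ(n₁,n₂)(H(n₁,n₂)/max + 1) b_{n₁}²b_{n₂}²
    ≤ 3T_lT_rT(1+log N) H²(HK+N) ∑ ϱ(n) b_n⁴` (`zsum_le`, `boxsumB_le`; `τ ≤ ϱ`, `(∑b²)² ≤ N∑b⁴`).
   This elementary route replaces the printed intermediate bound for `B''(l, r)` (p. 231), which
   uses `ν ≤ (H/N + 1)(n₁,n₂)` and is therefore adapted to coefficients supported on `n ∼ N` (the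
   case of the application (9.13)); the bound (9.18) itself, and hence (9.15), is obtained here for
   arbitrary `β_n`, `1 ≤ n ≤ N`, as Lemma 7 states.
7. "Finally, we complete the proof of Lemma 7 by (9.16), (9.17), Lemma 1 and (9.18)":
   `blockB_le_of_K1`, the size estimates `lemma1I_le7`, `eps_factor_le7`, `sqrt_boxsumB_le`,
   `diag_block_le` (all logarithms and divisor functions absorbed into `(CDKHN)^η`, the divisor
   function by `DivisorBound`), the assembly `dispBm_le_pos` (`a > 0`), and `a < 0` by
   `𝓑_m(−a; β) = 𝓑_m(a; β̄)` (`dispBm_neg`).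

## Main statements

* `BFI.L7.dispBm_le_of_lemma1` — Lemma 7 for `𝓑_m`, all `a ≠ 0`, with the bracket `BFI.L7.bracket7`.
* **`BFI.lemma7_dispBm_of_lemma1`** — the same in the shape `dispBm ≤ C₇ · BFI.lemma7Rhs …` of the
  hypothesis `h7` of `BFI.BombieriFriedlanderIwaniecTheorem2_of_lemma7`;
  `BFI.lemma7_dispBm_of_lemma1'` — from the printed form of Lemma 1 (all smooth compactly
  supported weights).

## References

* E. Bombieri, J. B. Friedlander, H. Iwaniec, Acta Math. 156 (1986), 203–251: §2 Lemma 1 p. 210;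
  §9 (9.14)–(9.18), Lemma 7 and its proof, pp. 230–231. [BombieriFriedlanderIwaniecActa1986]
* J.-M. Deshouillers, H. Iwaniec, *Kloosterman sums and Fourier coefficients of cusp forms*,
  Invent. Math. 70 (1982), 219–288, Theorem 12 (BFI's reference [2]).
-/

noncomputable section

open Finset Real
open scoped ArithmeticFunction.sigma FourierTransform ComplexConjugate ContDiff

namespace Literature.NumberTheory.Sieve

namespace BFI

namespace L7

/-! ### Counting lemmas -/

/-- **`∑_{1 ≤ m ≤ M} (n, m)/m ≤ τ(n) (1 + log M)`** for `n ≥ 1`: group by `g = (n, m) ∣ n`; the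
`m ≤ M` divisible by `g` contribute `∑_{j ≤ M/g} 1/j ≤ 1 + log M`. [folklore] -/
theorem sum_gcd_div_le {n : ℕ} (hn : n ≠ 0) (M : ℕ) :
    ∑ m ∈ Icc 1 M, ((Nat.gcd n m : ℕ) : ℝ) / (m : ℝ) ≤ (#n.divisors : ℝ) * (1 + Real.log M) := by
  have hlogM : 0 ≤ Real.log (M : ℝ) := Real.log_natCast_nonneg M
  -- `(n,m)/m = 1/(m/(n,m))` and `m/(n,m)` runs over `[1, M]` at most `τ(n)` times... we argue by
  -- grouping according to the value `g = (n, m)`.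
  have hstep : ∀ m ∈ Icc 1 M, ((Nat.gcd n m : ℕ) : ℝ) / (m : ℝ) =
      ∑ g ∈ n.divisors, if Nat.gcd n m = g then (g : ℝ) / (m : ℝ) else 0 := by
    intro m _
    rw [Finset.sum_ite_eq n.divisors (Nat.gcd n m) (fun g => (g : ℝ) / (m : ℝ))]
    rw [if_pos]
    exact Nat.mem_divisors.2 ⟨Nat.gcd_dvd_left n m, hn⟩
  rw [Finset.sum_congr rfl hstep, Finset.sum_comm]
  have hg : ∀ g ∈ n.divisors, ∑ m ∈ Icc 1 M, (if Nat.gcd n m = g then (g : ℝ) / (m : ℝ) else 0) ≤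
      1 + Real.log M := by
    intro g hgd
    have hg0 : 0 < g := Nat.pos_of_mem_divisors hgd
    have hg0' : (0 : ℝ) < g := by exact_mod_cast hg0
    -- the terms with `(n,m) = g` have `g ∣ m`; substitute `m = g j`
    calc ∑ m ∈ Icc 1 M, (if Nat.gcd n m = g then (g : ℝ) / (m : ℝ) else 0)
        ≤ ∑ m ∈ Icc 1 M, (if g ∣ m then (g : ℝ) / (m : ℝ) else 0) := by
          refine Finset.sum_le_sum fun m _ => ?_
          by_cases h : Nat.gcd n m = g
          · rw [if_pos h, if_pos (h ▸ Nat.gcd_dvd_right n m)]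
          · rw [if_neg h]; split_ifs <;> positivity
      _ = ∑ m ∈ (Icc 1 M).filter (fun m => g ∣ m), (g : ℝ) / (m : ℝ) := by
          rw [Finset.sum_filter]
      _ ≤ ∑ j ∈ Icc 1 (M / g), (g : ℝ) / ((g * j : ℕ) : ℝ) := by
          -- `m ↦ m / g` is a bijection onto `[1, M/g]` with inverse `j ↦ g j`
          refine le_of_eq ?_
          refine Finset.sum_nbij' (fun m => m / g) (fun j => g * j) ?_ ?_ ?_ ?_ ?_
          · intro m hm
            rw [Finset.mem_filter, Finset.mem_Icc] at hm
            rw [Finset.mem_Icc]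
            obtain ⟨⟨h1, h2⟩, ⟨c, hc⟩⟩ := hm
            subst hc
            rw [Nat.mul_div_cancel_left c hg0]
            constructor
            · rcases Nat.eq_zero_or_pos c with h | h
              · subst h; simp at h1
              · exact h
            · exact Nat.le_div_iff_mul_le hg0 |>.2 (by rw [mul_comm]; exact h2)
          · intro j hj
            rw [Finset.mem_Icc] at hj
            rw [Finset.mem_filter, Finset.mem_Icc]
            refine ⟨⟨?_, ?_⟩, ⟨j, rfl⟩⟩
            · calc 1 = 1 * 1 := rfl
                _ ≤ g * j := Nat.mul_le_mul hg0 hj.1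
            · calc g * j ≤ g * (M / g) := Nat.mul_le_mul_left g hj.2
                _ ≤ M := Nat.mul_div_le M g
          · intro m hm
            rw [Finset.mem_filter] at hm
            exact Nat.mul_div_cancel' hm.2
          · intro j _
            exact Nat.mul_div_cancel_left j hg0
          · intro m hm
            rw [Finset.mem_filter] at hm
            rw [Nat.mul_div_cancel' hm.2]
      _ = ∑ j ∈ Icc 1 (M / g), ((j : ℝ))⁻¹ := by
          refine Finset.sum_congr rfl fun j hj => ?_
          have hj0 : (0 : ℝ) < j := by exact_mod_cast (Finset.mem_Icc.1 hj).1
          push_cast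
          field_simp
      _ ≤ 1 + Real.log ((M / g : ℕ) : ℝ) := harmonic_Icc_le (M / g)
      _ ≤ 1 + Real.log M := by
          rcases Nat.eq_zero_or_pos (M / g) with h | h
          · rw [h]; simp only [Nat.cast_zero, Real.log_zero, add_zero]; linarith
          · have h1 : ((M / g : ℕ) : ℝ) ≤ M := by exact_mod_cast Nat.div_le_self M g
            have h2 : (0 : ℝ) < ((M / g : ℕ) : ℝ) := by exact_mod_cast h
            linarith [Real.log_le_log h2 h1]
  calc ∑ g ∈ n.divisors, ∑ m ∈ Icc 1 M, (if Nat.gcd n m = g then (g : ℝ) / (m : ℝ) else 0)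
      ≤ ∑ g ∈ n.divisors, (1 + Real.log M) := Finset.sum_le_sum hg
    _ = (#n.divisors : ℝ) * (1 + Real.log M) := by rw [Finset.sum_const, nsmul_eq_mul]

/-- **`∑_{1 ≤ m ≤ M} (n, m)/max(n, m) ≤ τ(n)(1 + log M)`** (`max(n, m) ≥ m`). [folklore] -/
theorem sum_gcd_div_max_le {n : ℕ} (hn : n ≠ 0) (M : ℕ) :
    ∑ m ∈ Icc 1 M, ((Nat.gcd n m : ℕ) : ℝ) / ((max n m : ℕ) : ℝ) ≤
      (#n.divisors : ℝ) * (1 + Real.log M) := by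
  refine le_trans (Finset.sum_le_sum fun m hm => ?_) (sum_gcd_div_le hn M)
  have hm0 : (0 : ℝ) < m := by exact_mod_cast (Finset.mem_Icc.1 hm).1
  have hmax : (m : ℝ) ≤ ((max n m : ℕ) : ℝ) := by exact_mod_cast le_max_right n m
  exact div_le_div_of_nonneg_left (Nat.cast_nonneg _) hm0 hmax

/-- `τ(n) ≤ ϱ(n)` (each `gcd(d, n/d) ≥ 1`). [folklore] -/
theorem card_divisors_le_rho (n : ℕ) : (#n.divisors : ℝ) ≤ (rho n : ℝ) := by
  unfold rho
  have h : #n.divisors = ∑ d ∈ n.divisors, 1 := Finset.card_eq_sum_ones _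
  rw [h]
  push_cast
  refine Finset.sum_le_sum fun d hd => ?_
  have hd0 : 0 < d := Nat.pos_of_mem_divisors hd
  exact_mod_cast Nat.gcd_pos_of_pos_left (n / d) hd0

/-- **The number of `1 ≤ k ≤ K` with `n₁ ≡ n₂ (mod m k)` is at most `τ(|n₁ − n₂|)`** when
`n₁ ≠ n₂` (such `k` divide `|n₁ − n₂|`). [folklore] -/
theorem card_filter_modEq_le {n₁ n₂ : ℕ} (hne : n₁ ≠ n₂) (m K : ℕ) :
    #((Icc 1 K).filter (fun k => n₁ ≡ n₂ [MOD m * k])) ≤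
      #(Int.natAbs ((n₁ : ℤ) - n₂)).divisors := by
  refine Finset.card_le_card_of_injOn id (fun k hk => ?_) (Set.injOn_id _)
  rw [Finset.mem_coe, Finset.mem_filter] at hk
  rw [id, Finset.mem_coe, Nat.mem_divisors]
  refine ⟨?_, ?_⟩
  · have h1 : ((m * k : ℕ) : ℤ) ∣ (n₂ : ℤ) - n₁ := (Nat.modEq_iff_dvd.1 hk.2)
    have h2 : (k : ℤ) ∣ (n₁ : ℤ) - n₂ := by
      have : (k : ℤ) ∣ ((m * k : ℕ) : ℤ) := ⟨m, by push_cast; ring⟩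
      have h3 := this.trans h1
      rw [show (n₁ : ℤ) - n₂ = -((n₂ : ℤ) - n₁) by ring]
      exact h3.neg_right
    exact Int.natCast_dvd.1 h2
  · intro h
    apply hne
    have := Int.natAbs_eq_zero.1 h
    omega

/-- `(∑_{n ≤ N} u_n)² ≤ N ∑_{n ≤ N} u_n²` (Cauchy–Schwarz). [folklore] -/
theorem sq_sum_Icc_le (N : ℕ) (u : ℕ → ℝ) :
    (∑ n ∈ Icc 1 N, u n) ^ 2 ≤ (N : ℝ) * ∑ n ∈ Icc 1 N, u n ^ 2 := by
  have h := sq_sum_le_card_mul_sum_sq (s := Icc 1 N) (f := u)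
  rwa [Nat.card_Icc, add_tsub_cancel_right] at h

/-- `∑_{n₁, n₂ ≤ N} w(n₁, n₂) u_{n₁} u_{n₂} ≤ ∑_{n₁} u_{n₁}² · ∑_{n₂} w(n₁, n₂)` for a symmetric
weight `w ≥ 0` and `u ≥ 0` (`u₁u₂ ≤ (u₁² + u₂²)/2`). [folklore] -/
theorem sum_sum_symm_weight_le (N : ℕ) {w : ℕ → ℕ → ℝ} (hw : ∀ a b, 0 ≤ w a b)
    (hsymm : ∀ a b, w a b = w b a) (u : ℕ → ℝ) :
    ∑ n₁ ∈ Icc 1 N, ∑ n₂ ∈ Icc 1 N, w n₁ n₂ * (u n₁ * u n₂) ≤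
      ∑ n₁ ∈ Icc 1 N, u n₁ ^ 2 * ∑ n₂ ∈ Icc 1 N, w n₁ n₂ := by
  have h1 : ∑ n₁ ∈ Icc 1 N, ∑ n₂ ∈ Icc 1 N, w n₁ n₂ * (u n₁ * u n₂) ≤
      ∑ n₁ ∈ Icc 1 N, ∑ n₂ ∈ Icc 1 N, (w n₁ n₂ * u n₁ ^ 2 / 2 + w n₁ n₂ * u n₂ ^ 2 / 2) := by
    refine Finset.sum_le_sum fun n₁ _ => Finset.sum_le_sum fun n₂ _ => ?_
    have : u n₁ * u n₂ ≤ u n₁ ^ 2 / 2 + u n₂ ^ 2 / 2 := by nlinarith [sq_nonneg (u n₁ - u n₂)]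
    nlinarith [hw n₁ n₂]
  refine h1.trans (le_of_eq ?_)
  rw [Finset.sum_congr rfl fun n₁ _ => Finset.sum_add_distrib]
  rw [Finset.sum_add_distrib]
  have h2 : ∑ n₁ ∈ Icc 1 N, ∑ n₂ ∈ Icc 1 N, w n₁ n₂ * u n₂ ^ 2 / 2 =
      ∑ n₁ ∈ Icc 1 N, ∑ n₂ ∈ Icc 1 N, w n₁ n₂ * u n₁ ^ 2 / 2 := by
    rw [Finset.sum_comm]
    refine Finset.sum_congr rfl fun n₁ _ => Finset.sum_congr rfl fun n₂ _ => ?_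
    rw [hsymm]
  rw [h2, ← two_mul, Finset.mul_sum]
  refine Finset.sum_congr rfl fun n₁ _ => ?_
  rw [Finset.mul_sum, Finset.mul_sum]
  refine Finset.sum_congr rfl fun n₂ _ => ?_
  ring


/-! ### The admissibility condition coming from the characters modulo `mk` -/

/-- `adm q ((h₁,n₁),(h₂,n₂))`: `(n₁, q) = 1` and `n₁ ≡ n₂ (mod q)` — what the character average
`φ(q)⁻¹ ∑_{χ mod q} χ(n₁) χ̄(n₂)` detects. [folklore] -/
def adm (q : ℕ) (p : (ℕ × ℕ) × (ℕ × ℕ)) : Prop := p.1.2.Coprime q ∧ p.1.2 ≡ p.2.2 [MOD q]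

/-- `adm q` is decidable. [folklore] -/
instance (q : ℕ) : DecidablePred (adm q) := fun p => by unfold adm; infer_instance

/-- `adm` is invariant under the swap `((h₁,n₁),(h₂,n₂)) ↦ ((h₂,n₂),(h₁,n₁))`. [folklore] -/
theorem adm_swap (q : ℕ) (p : (ℕ × ℕ) × (ℕ × ℕ)) : adm q p.swap ↔ adm q p := by
  unfold adm
  simp only [Prod.fst_swap, Prod.snd_swap]
  constructor
  · rintro ⟨h1, h2⟩
    refine ⟨?_, h2.symm⟩
    unfold Nat.Coprime at h1 ⊢
    rw [h2.symm.gcd_eq]; exact h1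
  · rintro ⟨h1, h2⟩
    refine ⟨?_, h2.symm⟩
    unfold Nat.Coprime at h1 ⊢
    rw [h2.gcd_eq] at h1; exact h1

/-- The orthogonality indicator is the `adm` indicator:
`IsUnit n₂ ∧ n₂ = n₁ (in ZMod q)  ↔  adm q p`. [folklore] -/
theorem isUnit_and_eq_iff_adm (q : ℕ) (p : (ℕ × ℕ) × (ℕ × ℕ)) :
    (IsUnit ((p.2.2 : ℕ) : ZMod q) ∧ ((p.2.2 : ℕ) : ZMod q) = ((p.1.2 : ℕ) : ZMod q)) ↔ adm q p := by
  rw [ZMod.isUnit_iff_coprime, ZMod.natCast_eq_natCast_iff]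
  unfold adm
  constructor
  · rintro ⟨h1, h2⟩
    refine ⟨?_, h2.symm⟩
    unfold Nat.Coprime at h1 ⊢
    rw [h2.symm.gcd_eq]; exact h1
  · rintro ⟨h1, h2⟩
    refine ⟨?_, h2.symm⟩
    unfold Nat.Coprime at h1 ⊢
    rw [h2.gcd_eq] at h1; exact h1

/-! ### The smoothed block sum and its expansion -/

/-- The smoothed block
`∑_{c ≤ cM} ∑_{d ≤ dM} g(c,d) ∑_{k ≤ K} φ(mk)⁻¹ ∑_{χ (mod mk)} |∑_{h ≤ H} ∑_{n ≤ N,(nd,c)=1} β(h,n)χ(n) e(ahk(nd)‾/c)|²`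
(BFI p. 230: "it suffices to prove the result for a sum modified by a smooth weight function
`g(c, d)`"). [cite: BombieriFriedlanderIwaniecActa1986, §9 p. 230] -/
def blockB (a : ℤ) (m : ℕ) (g : ℕ → ℕ → ℝ) (cM dM K H N : ℕ) (β : ℕ → ℕ → ℂ) : ℝ :=
  ∑ c ∈ Icc 1 cM, ∑ d ∈ Icc 1 dM, g c d *
    ∑ k ∈ Icc 1 K, ((Nat.totient (m * k) : ℝ))⁻¹ *
      ∑ χ : DirichletCharacter ℂ (m * k), ‖bInner a m (H : ℝ) (N : ℝ) β c d k χ‖ ^ 2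

/-- `blockB ≥ 0` for `g ≥ 0`. [folklore] -/
theorem blockB_nonneg (a : ℤ) (m : ℕ) {g : ℕ → ℕ → ℝ} (hg : ∀ c d, 0 ≤ g c d) (cM dM K H N : ℕ)
    (β : ℕ → ℕ → ℂ) : 0 ≤ blockB a m g cM dM K H N β :=
  Finset.sum_nonneg fun c _ => Finset.sum_nonneg fun d _ => mul_nonneg (hg c d)
    (Finset.sum_nonneg fun _ _ => mul_nonneg (inv_nonneg.2 (Nat.cast_nonneg _))
      (Finset.sum_nonneg fun _ _ => by positivity))

/-- The inner sum of `𝓑_m` as a sum of `aterm · χ` over the box `[1,H] × [1,N]`. [folklore] -/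
theorem bInner_eq_sum_aterm (a : ℤ) (m H N : ℕ) (β : ℕ → ℕ → ℂ) (c d k : ℕ)
    (χ : DirichletCharacter ℂ (m * k)) :
    bInner a m (H : ℝ) (N : ℝ) β c d k χ =
      ∑ x ∈ Icc 1 H ×ˢ Icc 1 N, L6.aterm a β c d k x * χ ((x.2 : ℕ) : ZMod (m * k)) := by
  unfold bInner L6.aterm klNum
  rw [Nat.floor_natCast, Nat.floor_natCast, Finset.sum_product]
  refine Finset.sum_congr rfl fun h _ => ?_
  rw [Finset.sum_filter]
  refine Finset.sum_congr rfl fun n _ => ?_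
  have e1 : ((n * d : ℕ) : ZMod c) = ((d * n : ℕ) : ZMod c) := by rw [mul_comm]
  by_cases hc : c.Coprime (n * d)
  · have hc' : c.Coprime (d * n) := by rwa [mul_comm] at hc
    rw [if_pos hc, if_pos hc', e1]
    ring
  · have hc' : ¬ c.Coprime (d * n) := by rwa [mul_comm] at hc
    rw [if_neg hc, if_neg hc']
    ring

/-- **Orthogonality**: for `mk ≥ 1`,
`φ(mk)⁻¹ ∑_χ |∑_x aterm(x) χ(x₂)|² = ∑_{p ∈ pairs, adm (mk) p} aterm(p.1) conj aterm(p.2)`. [folklore] -/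
theorem inv_totient_mul_sum_normSq (a : ℤ) {m : ℕ} (hm : 0 < m) (H N : ℕ) (β : ℕ → ℕ → ℂ)
    (c d : ℕ) {k : ℕ} (hk : 0 < k) :
    ((Nat.totient (m * k) : ℂ))⁻¹ *
        ∑ χ : DirichletCharacter ℂ (m * k), (((‖bInner a m (H : ℝ) (N : ℝ) β c d k χ‖ : ℝ) : ℂ)) ^ 2 =
      ∑ p ∈ (L6.pairs H N).filter (adm (m * k)),
        L6.aterm a β c d k p.1 * conj (L6.aterm a β c d k p.2) := by
  haveI : NeZero (m * k) := ⟨(Nat.mul_pos hm hk).ne'⟩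
  have hφ : (Nat.totient (m * k) : ℂ) ≠ 0 := by
    exact_mod_cast (Nat.totient_pos.2 (Nat.mul_pos hm hk)).ne'
  -- expand the squares
  have hsq : ∀ χ : DirichletCharacter ℂ (m * k),
      (((‖bInner a m (H : ℝ) (N : ℝ) β c d k χ‖ : ℝ) : ℂ)) ^ 2 =
        ∑ p ∈ L6.pairs H N, (L6.aterm a β c d k p.1 * conj (L6.aterm a β c d k p.2)) *
          (χ ((p.1.2 : ℕ) : ZMod (m * k)) * conj (χ ((p.2.2 : ℕ) : ZMod (m * k)))) := by
    intro χ
    rw [← Complex.ofReal_pow, L6.ofReal_norm_sq_eq_mul_conj, bInner_eq_sum_aterm, map_sum,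
      Finset.sum_mul_sum, L6.pairs, ← Finset.sum_product']
    refine Finset.sum_congr rfl fun p _ => ?_
    rw [map_mul]
    ring
  simp_rw [hsq]
  rw [Finset.sum_comm, Finset.mul_sum, Finset.sum_filter]
  refine Finset.sum_congr rfl fun p _ => ?_
  rw [← Finset.mul_sum]
  have horth : ∑ χ : DirichletCharacter ℂ (m * k),
      χ ((p.1.2 : ℕ) : ZMod (m * k)) * conj (χ ((p.2.2 : ℕ) : ZMod (m * k))) =
      if adm (m * k) p then (Nat.totient (m * k) : ℂ) else 0 := by
    have h := sum_conj_char_mul_char (q := m * k) p.2.2 p.1.2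
    have h' : ∑ χ : DirichletCharacter ℂ (m * k),
        χ ((p.1.2 : ℕ) : ZMod (m * k)) * conj (χ ((p.2.2 : ℕ) : ZMod (m * k))) =
        ∑ χ : DirichletCharacter ℂ (m * k),
          starRingEnd ℂ (χ ((p.2.2 : ℕ) : ZMod (m * k))) * χ ((p.1.2 : ℕ) : ZMod (m * k)) :=
      Finset.sum_congr rfl fun χ _ => mul_comm _ _
    rw [h', h]
    by_cases hadm : adm (m * k) p
    · rw [if_pos hadm, if_pos ((isUnit_and_eq_iff_adm _ _).2 hadm)]
    · rw [if_neg hadm, if_neg (fun h'' => hadm ((isUnit_and_eq_iff_adm _ _).1 h''))]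
  rw [horth]
  split_ifs
  · field_simp
  · simp

/-- The admissible index set `T^{(m)} = {(k, p) ∈ [1,K] × pairs : adm (mk) p}`. [folklore] -/
def tsetB (m K H N : ℕ) : Finset (ℕ × ((ℕ × ℕ) × (ℕ × ℕ))) :=
  (L6.tset K H N).filter (fun t => adm (m * t.1) t.2)

/-- **The expanded square** (BFI p. 230, "Squaring and changing the order of summation"):
`blockB = ∑_{t ∈ T^{(m)}} w_t · Inner(a k m_t, r_t)`. [cite: BombieriFriedlanderIwaniecActa1986, §9 p. 230] -/
theorem blockB_eq_Zpart (a : ℤ) {m : ℕ} (hm : 0 < m) (g : ℕ → ℕ → ℝ) (cM dM K H N : ℕ)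
    (β : ℕ → ℕ → ℂ) :
    ((blockB a m g cM dM K H N β : ℝ) : ℂ) = L6.Zpart (tsetB m K H N) a g cM dM β := by
  unfold blockB L6.Zpart tsetB L6.tset
  push_cast
  -- the character sums, for `k ≥ 1`
  have hk : ∀ c d : ℕ, ∀ k ∈ Icc 1 K, ((Nat.totient (m * k) : ℂ))⁻¹ *
      ∑ χ : DirichletCharacter ℂ (m * k), (((‖bInner a m (H : ℝ) (N : ℝ) β c d k χ‖ : ℝ) : ℂ)) ^ 2 =
      ∑ p ∈ (L6.pairs H N).filter (adm (m * k)),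
        L6.aterm a β c d k p.1 * conj (L6.aterm a β c d k p.2) :=
    fun c d k hk => inv_totient_mul_sum_normSq a hm H N β c d (Finset.mem_Icc.1 hk).1
  rw [Finset.sum_congr rfl fun c _ => Finset.sum_congr rfl fun d _ =>
    congrArg (fun z => ((g c d : ℝ) : ℂ) * z) (Finset.sum_congr rfl (hk c d))]
  -- the right side as `∑_k ∑_{p : adm}`
  rw [Finset.sum_filter, Finset.sum_product]
  simp_rw [← Finset.sum_filter]
  -- reorder `∑_c ∑_d ∑_k ∑_p = ∑_k ∑_p ∑_c ∑_d` and use the `(c,d)`-summation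
  simp_rw [Finset.mul_sum]
  simp_rw [Finset.sum_comm (s := Icc 1 dM) (t := Icc 1 K)]
  rw [Finset.sum_comm (s := Icc 1 cM) (t := Icc 1 K)]
  refine Finset.sum_congr rfl fun k _ => ?_
  simp_rw [Finset.sum_comm (s := Icc 1 dM) (t := (L6.pairs H N).filter (adm (m * k)))]
  rw [Finset.sum_comm (s := Icc 1 cM) (t := (L6.pairs H N).filter (adm (m * k)))]
  refine Finset.sum_congr rfl fun p _ => ?_
  exact L6.sum_g_mul_aterm_mul_conj a β g cM dM k p

/-! ### Splitting according to the sign of `m_t = h₁n₂ − h₂n₁` -/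

/-- `T₀^{(m)} = {m_t = 0}`. [folklore] -/
def tsetBZero (m K H N : ℕ) : Finset (ℕ × ((ℕ × ℕ) × (ℕ × ℕ))) :=
  (tsetB m K H N).filter (fun t => L6.mval t.2 = 0)

/-- `T₊^{(m)} = {m_t > 0}`. [folklore] -/
def tsetBPos (m K H N : ℕ) : Finset (ℕ × ((ℕ × ℕ) × (ℕ × ℕ))) :=
  (tsetB m K H N).filter (fun t => 0 < L6.mval t.2)

/-- `T₋^{(m)} = {m_t < 0}`. [folklore] -/
def tsetBNeg (m K H N : ℕ) : Finset (ℕ × ((ℕ × ℕ) × (ℕ × ℕ))) :=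
  (tsetB m K H N).filter (fun t => L6.mval t.2 < 0)

/-- `Z = Z₀ + Z₊ + Z₋`. [folklore] -/
theorem Zpart_tsetB_eq_three_parts (a : ℤ) (m : ℕ) (g : ℕ → ℕ → ℝ) (cM dM K H N : ℕ)
    (β : ℕ → ℕ → ℂ) :
    L6.Zpart (tsetB m K H N) a g cM dM β =
      L6.Zpart (tsetBZero m K H N) a g cM dM β + L6.Zpart (tsetBPos m K H N) a g cM dM β +
        L6.Zpart (tsetBNeg m K H N) a g cM dM β := by
  unfold L6.Zpart tsetBZero tsetBPos tsetBNeg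
  rw [← Finset.sum_filter_add_sum_filter_not (tsetB m K H N) (fun t => L6.mval t.2 = 0), add_assoc]
  congr 1
  rw [← Finset.sum_filter_add_sum_filter_not ((tsetB m K H N).filter (fun t => ¬ L6.mval t.2 = 0))
    (fun t => 0 < L6.mval t.2), Finset.filter_filter, Finset.filter_filter]
  congr 1
  · refine Finset.sum_congr (Finset.filter_congr fun t _ => ?_) fun _ _ => rfl
    constructor
    · exact fun h => h.2
    · exact fun h => ⟨h.ne', h⟩
  · refine Finset.sum_congr (Finset.filter_congr fun t _ => ?_) fun _ _ => rfl
    constructor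
    · intro h; omega
    · intro h; omega

/-- Membership in `T^{(m)}` is swap-invariant. [folklore] -/
theorem swap_mem_tsetB {m K H N : ℕ} {t : ℕ × ((ℕ × ℕ) × (ℕ × ℕ))} (ht : t ∈ tsetB m K H N) :
    (t.1, t.2.swap) ∈ tsetB m K H N := by
  simp only [tsetB, L6.tset, Finset.mem_filter, Finset.mem_product] at ht ⊢
  exact ⟨⟨ht.1.1, L6.swap_mem_pairs ht.1.2⟩, (adm_swap _ _).2 ht.2⟩

/-- **`Z₋ = conj Z₊`.** [folklore] -/
theorem Zpart_neg_eq_conj (a : ℤ) (m : ℕ) (g : ℕ → ℕ → ℝ) (cM dM K H N : ℕ) (β : ℕ → ℕ → ℂ) :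
    L6.Zpart (tsetBNeg m K H N) a g cM dM β = conj (L6.Zpart (tsetBPos m K H N) a g cM dM β) := by
  unfold L6.Zpart
  rw [map_sum]
  refine Finset.sum_nbij' (fun t => (t.1, t.2.swap)) (fun t => (t.1, t.2.swap)) ?_ ?_ ?_ ?_ ?_
  · intro t ht
    simp only [tsetBNeg, tsetBPos, Finset.mem_filter] at ht ⊢
    exact ⟨swap_mem_tsetB ht.1, by rw [L6.mval_swap]; linarith⟩
  · intro t ht
    simp only [tsetBNeg, tsetBPos, Finset.mem_filter] at ht ⊢
    exact ⟨swap_mem_tsetB ht.1, by rw [L6.mval_swap]; linarith⟩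
  · intro t _; simp
  · intro t _; simp
  · intro t _
    simp only
    rw [map_mul, L6.wt_swap, Complex.conj_conj, L6.mval_swap, L6.rval_swap, ← L6.inner_neg]
    congr 2
    ring

/-- **`blockB ≤ |Z₀| + 2|Z₊|`.** [folklore] -/
theorem blockB_le_parts (a : ℤ) {m : ℕ} (hm : 0 < m) (g : ℕ → ℕ → ℝ) (cM dM K H N : ℕ)
    (β : ℕ → ℕ → ℂ) :
    blockB a m g cM dM K H N β ≤
      ‖L6.Zpart (tsetBZero m K H N) a g cM dM β‖ + 2 * ‖L6.Zpart (tsetBPos m K H N) a g cM dM β‖ := by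
  have h := blockB_eq_Zpart a hm g cM dM K H N β
  rw [Zpart_tsetB_eq_three_parts, Zpart_neg_eq_conj] at h
  have hre := congrArg Complex.re h
  rw [Complex.ofReal_re, Complex.add_re, Complex.add_re, Complex.conj_re] at hre
  rw [hre]
  have h1 := Complex.re_le_norm (L6.Zpart (tsetBZero m K H N) a g cM dM β)
  have h2 := Complex.re_le_norm (L6.Zpart (tsetBPos m K H N) a g cM dM β)
  linarith


/-! ### The diagonal part `Z₀` (BFI (9.16)) -/

/-- `|w_t| ≤ |b_{n₁}| |b_{n₂}|` when `|β(h, n)| ≤ |b_n|`. [folklore] -/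
theorem norm_wt_le_abs {b : ℕ → ℝ} {β : ℕ → ℕ → ℂ} (hβ : ∀ h n, ‖β h n‖ ≤ |b n|)
    (p : (ℕ × ℕ) × (ℕ × ℕ)) : ‖L6.wt β p‖ ≤ |b p.1.2| * |b p.2.2| := by
  unfold L6.wt
  rw [norm_mul, Complex.norm_conj]
  exact mul_le_mul (hβ _ _) (hβ _ _) (norm_nonneg _) (abs_nonneg _)

/-- `T₀^{(m)} ⊆ T₀` (forget the admissibility). [folklore] -/
theorem tsetBZero_subset (m K H N : ℕ) : tsetBZero m K H N ⊆ L6.tsetZero K H N := by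
  intro t ht
  simp only [tsetBZero, tsetB, L6.tsetZero, Finset.mem_filter] at ht ⊢
  exact ⟨ht.1.1, ht.2⟩

/-- `|Z₀| ≤ (∑_{c,d} g) · ∑_{t ∈ T₀} |b_{n₁}||b_{n₂}|` (trivially, for `g ≥ 0`). [folklore] -/
theorem norm_Zpart_zero_le (a : ℤ) (m : ℕ) {g : ℕ → ℕ → ℝ} (hg : ∀ c d, 0 ≤ g c d)
    (cM dM K H N : ℕ) {b : ℕ → ℝ} {β : ℕ → ℕ → ℂ} (hβ : ∀ h n, ‖β h n‖ ≤ |b n|) :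
    ‖L6.Zpart (tsetBZero m K H N) a g cM dM β‖ ≤
      (∑ c ∈ Icc 1 cM, ∑ d ∈ Icc 1 dM, g c d) *
        ∑ t ∈ L6.tsetZero K H N, |b t.2.1.2| * |b t.2.2.2| := by
  unfold L6.Zpart
  set G := ∑ c ∈ Icc 1 cM, ∑ d ∈ Icc 1 dM, g c d with hG
  have hG0 : 0 ≤ G := Finset.sum_nonneg fun c _ => Finset.sum_nonneg fun d _ => hg c d
  refine (norm_sum_le _ _).trans ?_
  calc ∑ t ∈ tsetBZero m K H N, ‖L6.wt β t.2 * L6.inner g cM dM (a * t.1 * L6.mval t.2) (L6.rval t.2)‖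
      ≤ ∑ t ∈ tsetBZero m K H N, |b t.2.1.2| * |b t.2.2.2| * G := by
        refine Finset.sum_le_sum fun t _ => ?_
        rw [norm_mul]
        exact mul_le_mul (norm_wt_le_abs hβ _) (L6.norm_inner_le hg _ _ _ _) (norm_nonneg _)
          (by positivity)
    _ ≤ ∑ t ∈ L6.tsetZero K H N, |b t.2.1.2| * |b t.2.2.2| * G :=
        Finset.sum_le_sum_of_subset_of_nonneg (tsetBZero_subset m K H N) fun _ _ _ => by positivity
    _ = G * ∑ t ∈ L6.tsetZero K H N, |b t.2.1.2| * |b t.2.2.2| := by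
        rw [← Finset.sum_mul, mul_comm]

/-- The swap symmetry of `T₀`: `∑_{t ∈ T₀} F(n₂) = ∑_{t ∈ T₀} F(n₁)`. [folklore] -/
theorem sum_tsetZero_swap (K H N : ℕ) (F : ℕ → ℝ) :
    ∑ t ∈ L6.tsetZero K H N, F t.2.2.2 = ∑ t ∈ L6.tsetZero K H N, F t.2.1.2 := by
  refine Finset.sum_nbij' (fun t => (t.1, t.2.swap)) (fun t => (t.1, t.2.swap)) ?_ ?_ ?_ ?_ ?_
  · intro t ht
    simp only [L6.tsetZero, L6.tset, Finset.mem_filter, Finset.mem_product] at ht ⊢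
    exact ⟨⟨ht.1.1, L6.swap_mem_pairs ht.1.2⟩, by rw [L6.mval_swap, ht.2, neg_zero]⟩
  · intro t ht
    simp only [L6.tsetZero, L6.tset, Finset.mem_filter, Finset.mem_product] at ht ⊢
    exact ⟨⟨ht.1.1, L6.swap_mem_pairs ht.1.2⟩, by rw [L6.mval_swap, ht.2, neg_zero]⟩
  · intro t _; simp
  · intro t _; simp
  · intro t _; simp

/-- `∑_{t ∈ T₀} |b_{n₁}||b_{n₂}| ≤ ∑_{t ∈ T₀} b_{n₁}²` (AM–GM and the swap symmetry). [folklore] -/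
theorem sum_tsetZero_abs_mul_le (K H N : ℕ) (b : ℕ → ℝ) :
    ∑ t ∈ L6.tsetZero K H N, |b t.2.1.2| * |b t.2.2.2| ≤ ∑ t ∈ L6.tsetZero K H N, b t.2.1.2 ^ 2 := by
  have h1 : ∑ t ∈ L6.tsetZero K H N, |b t.2.1.2| * |b t.2.2.2| ≤
      ∑ t ∈ L6.tsetZero K H N, (b t.2.1.2 ^ 2 / 2 + b t.2.2.2 ^ 2 / 2) := by
    refine Finset.sum_le_sum fun t _ => ?_
    nlinarith [sq_nonneg (|b t.2.1.2| - |b t.2.2.2|), sq_abs (b t.2.1.2), sq_abs (b t.2.2.2)]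
  refine h1.trans (le_of_eq ?_)
  rw [Finset.sum_add_distrib, ← Finset.sum_div, ← Finset.sum_div,
    sum_tsetZero_swap K H N (fun n => b n ^ 2)]
  ring

/-- `♯{h₁,h₂ ≤ H : h₁n₂ = h₂n₁}` as a double indicator sum. [folklore] -/
theorem card_diagPairs_eq_sum (n₁ n₂ H : ℕ) :
    (#(diagPairs n₁ n₂ H) : ℝ) =
      ∑ h₁ ∈ Icc 1 H, ∑ h₂ ∈ Icc 1 H, if h₁ * n₂ = h₂ * n₁ then (1 : ℝ) else 0 := by
  unfold diagPairs
  rw [Finset.card_filter, Nat.cast_sum, Finset.sum_product]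
  refine Finset.sum_congr rfl fun h₁ _ => Finset.sum_congr rfl fun h₂ _ => ?_
  split_ifs <;> simp

/-- **`∑_{t ∈ T₀} F(n₁) = K ∑_{n₁} F(n₁) ∑_{n₂} ♯{h₁,h₂ : h₁n₂ = h₂n₁}`.** [folklore] -/
theorem sum_tsetZero_eq (K H N : ℕ) (F : ℕ → ℝ) :
    ∑ t ∈ L6.tsetZero K H N, F t.2.1.2 =
      K * ∑ n₁ ∈ Icc 1 N, F n₁ * ∑ n₂ ∈ Icc 1 N, (#(diagPairs n₁ n₂ H) : ℝ) := by
  have h1 : L6.tsetZero K H N = Icc 1 K ×ˢ (L6.pairs H N).filter (fun p => L6.mval p = 0) := by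
    unfold L6.tsetZero L6.tset
    exact Finset.filter_product_right (q := fun p => L6.mval p = 0)
  rw [h1, Finset.sum_product]
  dsimp only
  rw [Finset.sum_const, Nat.card_Icc, add_tsub_cancel_right, nsmul_eq_mul]
  congr 1
  simp_rw [card_diagPairs_eq_sum]
  rw [Finset.sum_filter, L6.pairs, Finset.sum_product, Finset.sum_product]
  simp_rw [Finset.sum_product]
  -- match the indicators
  have h3 : ∀ h₁ n₁ h₂ n₂ : ℕ, (if L6.mval ((h₁, n₁), (h₂, n₂)) = 0 then F n₁ else 0) =
      F n₁ * (if h₁ * n₂ = h₂ * n₁ then (1 : ℝ) else 0) := by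
    intro h₁ n₁ h₂ n₂
    unfold L6.mval
    simp only [sub_eq_zero]
    by_cases h : h₁ * n₂ = h₂ * n₁
    · rw [if_pos h, if_pos (by exact_mod_cast h), mul_one]
    · rw [if_neg h, if_neg (fun h' => h (by exact_mod_cast h')), mul_zero]
  simp_rw [h3]
  rw [Finset.sum_comm (s := Icc 1 H) (t := Icc 1 N)]
  refine Finset.sum_congr rfl fun n₁ _ => ?_
  rw [Finset.mul_sum]
  simp_rw [Finset.mul_sum]
  simp_rw [Finset.sum_comm (s := Icc 1 H) (t := Icc 1 N)]

/-- **The diagonal count with weights**: `∑_{t ∈ T₀} b_{n₁}² ≤ K H (1 + log N) ∑_{n ≤ N} τ(n) b_n²`.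
[cite: BombieriFriedlanderIwaniecActa1986, §9 (9.16) p. 230] -/
theorem sum_tsetZero_sq_le (K H N : ℕ) (b : ℕ → ℝ) :
    ∑ t ∈ L6.tsetZero K H N, b t.2.1.2 ^ 2 ≤
      K * H * (1 + Real.log N) * ∑ n ∈ Icc 1 N, (#n.divisors : ℝ) * b n ^ 2 := by
  rw [sum_tsetZero_eq K H N (fun n => b n ^ 2)]
  have hlog : 0 ≤ 1 + Real.log N := by
    have := Real.log_natCast_nonneg N; linarith
  have h1 : ∀ n₁ ∈ Icc 1 N, ∑ n₂ ∈ Icc 1 N, (#(diagPairs n₁ n₂ H) : ℝ) ≤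
      H * ((#n₁.divisors : ℝ) * (1 + Real.log N)) := by
    intro n₁ hn₁
    have hn₁0 : n₁ ≠ 0 := by have := (Finset.mem_Icc.1 hn₁).1; omega
    calc ∑ n₂ ∈ Icc 1 N, (#(diagPairs n₁ n₂ H) : ℝ)
        ≤ ∑ n₂ ∈ Icc 1 N, (H : ℝ) * (((Nat.gcd n₁ n₂ : ℕ) : ℝ) / ((max n₁ n₂ : ℕ) : ℝ)) := by
          refine Finset.sum_le_sum fun n₂ hn₂ => ?_
          have hn₂0 : n₂ ≠ 0 := by have := (Finset.mem_Icc.1 hn₂).1; omega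
          rw [← mul_div_assoc]
          exact card_diagPairs_le hn₁0 hn₂0
      _ = (H : ℝ) * ∑ n₂ ∈ Icc 1 N, ((Nat.gcd n₁ n₂ : ℕ) : ℝ) / ((max n₁ n₂ : ℕ) : ℝ) := by
          rw [Finset.mul_sum]
      _ ≤ H * ((#n₁.divisors : ℝ) * (1 + Real.log N)) :=
          mul_le_mul_of_nonneg_left (sum_gcd_div_max_le hn₁0 N) (Nat.cast_nonneg _)
  calc (K : ℝ) * ∑ n₁ ∈ Icc 1 N, b n₁ ^ 2 * ∑ n₂ ∈ Icc 1 N, (#(diagPairs n₁ n₂ H) : ℝ)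
      ≤ (K : ℝ) * ∑ n₁ ∈ Icc 1 N, b n₁ ^ 2 * (H * ((#n₁.divisors : ℝ) * (1 + Real.log N))) := by
        refine mul_le_mul_of_nonneg_left (Finset.sum_le_sum fun n₁ hn₁ => ?_) (Nat.cast_nonneg _)
        exact mul_le_mul_of_nonneg_left (h1 n₁ hn₁) (sq_nonneg _)
    _ = K * H * (1 + Real.log N) * ∑ n ∈ Icc 1 N, (#n.divisors : ℝ) * b n ^ 2 := by
        rw [Finset.mul_sum, Finset.mul_sum]
        refine Finset.sum_congr rfl fun n _ => ?_
        ring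

/-- **The diagonal** (BFI (9.16): "The terms on the diagonal (`l = 0`) are trivially found to
contribute `≪ (HKN)^ε CDHK ∑|β_n|²`"):
`|Z₀| ≤ (∑_{c,d} g) · K H (1 + log N) ∑_{n ≤ N} τ(n) b_n²`. [cite: BombieriFriedlanderIwaniecActa1986, §9 (9.16) p. 230] -/
theorem diag_le (a : ℤ) (m : ℕ) {g : ℕ → ℕ → ℝ} (hg : ∀ c d, 0 ≤ g c d) (cM dM K H N : ℕ)
    {b : ℕ → ℝ} {β : ℕ → ℕ → ℂ} (hβ : ∀ h n, ‖β h n‖ ≤ |b n|) :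
    ‖L6.Zpart (tsetBZero m K H N) a g cM dM β‖ ≤
      (∑ c ∈ Icc 1 cM, ∑ d ∈ Icc 1 dM, g c d) *
        (K * H * (1 + Real.log N) * ∑ n ∈ Icc 1 N, (#n.divisors : ℝ) * b n ^ 2) := by
  refine (norm_Zpart_zero_le a m hg cM dM K H N hβ).trans ?_
  have hG0 : 0 ≤ ∑ c ∈ Icc 1 cM, ∑ d ∈ Icc 1 dM, g c d :=
    Finset.sum_nonneg fun c _ => Finset.sum_nonneg fun d _ => hg c d
  exact mul_le_mul_of_nonneg_left
    ((sum_tsetZero_abs_mul_le K H N b).trans (sum_tsetZero_sq_le K H N b)) hG0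


/-! ### The positive part `Z₊`: the coefficients `B(l, r)` and the sums `𝓚` -/

/-- `T₊^{(m)} ⊆ T₊`. [folklore] -/
theorem tsetBPos_subset (m K H N : ℕ) : tsetBPos m K H N ⊆ L6.tsetPos K H N := by
  intro t ht
  simp only [tsetBPos, tsetB, L6.tsetPos, Finset.mem_filter] at ht ⊢
  exact ⟨ht.1.1, ht.2⟩

/-- **The coefficients `B(l, r)`** (BFI p. 230:
`B_{lr} = ∑_{n₁n₂=r, (k,n₁n₂)=1, n₁≡n₂ (k)} ∑_{h₁,h₂ ≤ H, a(h₁n₂−h₂n₁)k=l} β(h₁,n₁)β̄(h₂,n₂)`, here with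
the congruence modulo `mk`): the sum of the weights over the fibre of `t ↦ (l_t, r_t)` in `T₊^{(m)}`.
[cite: BombieriFriedlanderIwaniecActa1986, §9 p. 230] -/
def BcoefB (A m : ℕ) (β : ℕ → ℕ → ℂ) (K H N : ℕ) (y : ℕ × ℕ) : ℂ :=
  ∑ t ∈ (tsetBPos m K H N).filter (fun t => (L6.nNat A t, L6.rval t.2) = y), L6.wt β t.2

/-- **`Z₊ = ∑_{(l,r)} B(l,r) · Inner(l, r)`** (regrouping by the fibres of `t ↦ (l_t, r_t)`).
[cite: BombieriFriedlanderIwaniecActa1986, §9 p. 230] -/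
theorem Zpart_pos_eq_sum_BcoefB {A : ℕ} (hA : 1 ≤ A) (m : ℕ) (g : ℕ → ℕ → ℝ) (cM dM K H N : ℕ)
    (β : ℕ → ℕ → ℂ) {Rb : ℕ} (hRb : N * N ≤ Rb) :
    L6.Zpart (tsetBPos m K H N) (A : ℤ) g cM dM β =
      ∑ y ∈ Icc 1 (A * K * (H * N)) ×ˢ Icc 1 Rb,
        BcoefB A m β K H N y * L6.inner g cM dM (y.1 : ℤ) y.2 := by
  unfold L6.Zpart BcoefB
  rw [← Finset.sum_fiberwise_of_maps_to (g := fun t => (L6.nNat A t, L6.rval t.2))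
    (fun t ht => L6.key_mem hA (tsetBPos_subset m K H N ht) hRb)]
  refine Finset.sum_congr rfl fun y _ => ?_
  rw [Finset.sum_mul]
  refine Finset.sum_congr rfl fun t ht => ?_
  rw [Finset.mem_filter] at ht
  obtain ⟨ht, hy⟩ := ht
  have hpos : 0 < L6.mval t.2 := (Finset.mem_filter.1 (tsetBPos_subset m K H N ht)).2
  rw [← hy]
  simp only
  rw [L6.natCast_nNat A hpos]

/-- **`Z₊` as a sum of `L + 1` sums `𝓚`** over the dyadic blocks `r ∼ 2^i/2`, `0 ≤ i ≤ L`,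
`2^L ≥ N²`, each at `S = 1/2`, `N_𝓚 = AKHN`, with the coefficients `B(l, r)` (BFI p. 230: "we
transform `𝓑(C, D, K, H, N)` into `𝓚(C, D, |a|KHN, N², 1)`"). [cite: BombieriFriedlanderIwaniecActa1986, §9 p. 230] -/
theorem Zpart_pos_eq_sum_dispK {A : ℕ} (hA : 1 ≤ A) (m : ℕ) (g : ℕ → ℕ → ℝ) (cM dM K H N : ℕ)
    (β : ℕ → ℕ → ℂ) {L : ℕ} (hL : N * N ≤ 2 ^ L) :
    L6.Zpart (tsetBPos m K H N) (A : ℤ) g cM dM β =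
      ∑ i ∈ Finset.range (L + 1),
        dispK g cM dM (A * K * (H * N)) ((2 : ℝ) ^ i / 2) (1 / 2) (fun n r _ => BcoefB A m β K H N (n, r)) := by
  rw [Zpart_pos_eq_sum_BcoefB hA m g cM dM K H N β hL, Finset.sum_product, Finset.sum_comm,
    L6.sum_Icc_pow_eq_sum_dyadic]
  refine Finset.sum_congr rfl fun i _ => ?_
  rw [L6.dispK_half_eq]

/-! ### The bound for `‖B‖²` (BFI (9.18)) -/

/-- The fibre of `t ↦ (l_t, r_t)` over `y` in `T₊^{(m)}`. [folklore] -/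
def fiberB (A m K H N : ℕ) (y : ℕ × ℕ) : Finset (ℕ × ((ℕ × ℕ) × (ℕ × ℕ))) :=
  (tsetBPos m K H N).filter (fun t => (L6.nNat A t, L6.rval t.2) = y)

/-- `fibre^{(m)}(y) ⊆ fibre(y)`. [folklore] -/
theorem fiberB_subset (A m K H N : ℕ) (y : ℕ × ℕ) : fiberB A m K H N y ⊆ L6.fiber A K H N y :=
  Finset.filter_subset_filter _ (tsetBPos_subset m K H N)

/-- `μ'_z(y) = ♯{t ∈ fibre^{(m)}(y) : proj t = z}`. [folklore] -/
def muB (A m K H N : ℕ) (z : ℕ × (ℕ × ℕ)) (y : ℕ × ℕ) : ℕ :=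
  #((fiberB A m K H N y).filter (fun t => L6.proj t = z))

/-- `μ' ≤ μ`. [folklore] -/
theorem muB_le_mu (A m K H N : ℕ) (z : ℕ × (ℕ × ℕ)) (y : ℕ × ℕ) :
    muB A m K H N z y ≤ L6.mu A K H N z y :=
  Finset.card_le_card (Finset.filter_subset_filter _ (fiberB_subset A m K H N y))

/-- The weight `|b_{n₁}| |b_{n₂}|` attached to `z = (k, n₁, n₂)`. [folklore] -/
def bz (b : ℕ → ℝ) (z : ℕ × (ℕ × ℕ)) : ℝ := |b z.2.1| * |b z.2.2|

/-- **`|B(y)| ≤ ∑_z μ'_z(y) |b_{n₁}||b_{n₂}|`** (group the fibre by `proj`). [folklore] -/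
theorem norm_BcoefB_le (A m : ℕ) {b : ℕ → ℝ} {β : ℕ → ℕ → ℂ} (hβ : ∀ h n, ‖β h n‖ ≤ |b n|)
    (K H N : ℕ) (y : ℕ × ℕ) :
    ‖BcoefB A m β K H N y‖ ≤ ∑ z ∈ L6.Zset K N, (muB A m K H N z y : ℝ) * bz b z := by
  unfold BcoefB
  refine (norm_sum_le _ _).trans ?_
  calc ∑ t ∈ (tsetBPos m K H N).filter (fun t => (L6.nNat A t, L6.rval t.2) = y), ‖L6.wt β t.2‖
      ≤ ∑ t ∈ fiberB A m K H N y, bz b (L6.proj t) :=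
        Finset.sum_le_sum fun t _ => norm_wt_le_abs hβ t.2
    _ = ∑ z ∈ L6.Zset K N, ∑ t ∈ (fiberB A m K H N y).filter (fun t => L6.proj t = z), bz b (L6.proj t) := by
        rw [Finset.sum_fiberwise_of_maps_to]
        intro t ht
        exact L6.proj_mem_Zset (tsetBPos_subset m K H N (Finset.mem_filter.1 ht).1)
    _ = ∑ z ∈ L6.Zset K N, (muB A m K H N z y : ℝ) * bz b z := by
        refine Finset.sum_congr rfl fun z _ => ?_
        unfold muB
        rw [Finset.sum_congr rfl fun t ht => by rw [(Finset.mem_filter.1 ht).2], Finset.sum_const,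
          nsmul_eq_mul]

/-- `(∑_z u_z v_z)² ≤ ♯{u ≠ 0} · ∑_z (u_z v_z)²` (Cauchy–Schwarz on the support of `u`). [folklore] -/
theorem sq_sum_mul_le_card_support {ι : Type*} [DecidableEq ι] (s : Finset ι) (u : ι → ℕ) (v : ι → ℝ) :
    (∑ z ∈ s, (u z : ℝ) * v z) ^ 2 ≤
      #(s.filter (fun z => u z ≠ 0)) * ∑ z ∈ s, ((u z : ℝ) * v z) ^ 2 := by
  have h1 : ∑ z ∈ s, (u z : ℝ) * v z = ∑ z ∈ s.filter (fun z => u z ≠ 0), (u z : ℝ) * v z := by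
    rw [Finset.sum_filter_of_ne]
    intro z _ hz h0
    rw [h0, Nat.cast_zero, zero_mul] at hz
    exact hz rfl
  have h2 : ∑ z ∈ s.filter (fun z => u z ≠ 0), ((u z : ℝ) * v z) ^ 2 ≤ ∑ z ∈ s, ((u z : ℝ) * v z) ^ 2 :=
    Finset.sum_le_sum_of_subset_of_nonneg (Finset.filter_subset _ _) fun _ _ _ => by positivity
  rw [h1]
  refine (sq_sum_le_card_mul_sum_sq (s := s.filter (fun z => u z ≠ 0))
    (f := fun z => (u z : ℝ) * v z)).trans ?_
  exact mul_le_mul_of_nonneg_left h2 (Nat.cast_nonneg _)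

/-- **`|B(y)|² ≤ τ(l)τ(r) ∑_z μ'_z(y)² (|b_{n₁}||b_{n₂}|)²`.** [folklore] -/
theorem norm_sq_BcoefB_le (A m : ℕ) {b : ℕ → ℝ} {β : ℕ → ℕ → ℂ} (hβ : ∀ h n, ‖β h n‖ ≤ |b n|)
    (K H N : ℕ) {y : ℕ × ℕ} (hy1 : y.1 ≠ 0) (hy2 : y.2 ≠ 0) :
    ‖BcoefB A m β K H N y‖ ^ 2 ≤
      (#y.1.divisors * #y.2.divisors : ℕ) *
        ∑ z ∈ L6.Zset K N, ((muB A m K H N z y : ℝ) * bz b z) ^ 2 := by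
  have h1 := norm_BcoefB_le A m hβ K H N y
  have hcard : #((L6.Zset K N).filter (fun z => muB A m K H N z y ≠ 0)) ≤ #y.1.divisors * #y.2.divisors := by
    refine le_trans (Finset.card_le_card ?_) (L6.card_support_mu_le (A := A) (K := K) (H := H) (Q := N) hy1 hy2)
    intro z hz
    rw [Finset.mem_filter] at hz ⊢
    refine ⟨hz.1, fun h0 => hz.2 ?_⟩
    have := muB_le_mu A m K H N z y
    omega
  calc ‖BcoefB A m β K H N y‖ ^ 2 ≤ (∑ z ∈ L6.Zset K N, (muB A m K H N z y : ℝ) * bz b z) ^ 2 :=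
        pow_le_pow_left₀ (norm_nonneg _) h1 2
    _ ≤ #((L6.Zset K N).filter (fun z => muB A m K H N z y ≠ 0)) *
          ∑ z ∈ L6.Zset K N, ((muB A m K H N z y : ℝ) * bz b z) ^ 2 :=
        sq_sum_mul_le_card_support _ _ _
    _ ≤ (#y.1.divisors * #y.2.divisors : ℕ) *
          ∑ z ∈ L6.Zset K N, ((muB A m K H N z y : ℝ) * bz b z) ^ 2 := by
        refine mul_le_mul_of_nonneg_right ?_ (Finset.sum_nonneg fun _ _ => by positivity)
        exact_mod_cast hcard

/-- Admissibility of `z = (k, n₁, n₂)`: `(n₁, mk) = 1` and `n₁ ≡ n₂ (mod mk)`. [folklore] -/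
def admZ (m : ℕ) (z : ℕ × (ℕ × ℕ)) : Prop := z.2.1.Coprime (m * z.1) ∧ z.2.1 ≡ z.2.2 [MOD m * z.1]

/-- `admZ m` is decidable. [folklore] -/
instance (m : ℕ) : DecidablePred (admZ m) := fun z => by unfold admZ; infer_instance

/-- Off the admissible `z`, all `μ'_z(y)` vanish. [folklore] -/
theorem muB_eq_zero_of_not_admZ {A m K H N : ℕ} {z : ℕ × (ℕ × ℕ)} (hz : ¬ admZ m z) (y : ℕ × ℕ) :
    muB A m K H N z y = 0 := by
  by_contra h
  obtain ⟨t, ht⟩ := Finset.card_ne_zero.1 h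
  rw [Finset.mem_filter] at ht
  obtain ⟨ht, hproj⟩ := ht
  have ht' : t ∈ tsetBPos m K H N := (Finset.mem_filter.1 ht).1
  have hadm : adm (m * t.1) t.2 := (Finset.mem_filter.1 (Finset.mem_filter.1 ht').1).2
  apply hz
  simp only [L6.proj, Prod.ext_iff] at hproj
  obtain ⟨h1, h2, h3⟩ := hproj
  unfold admZ
  unfold adm at hadm
  rw [← h1, ← h2, ← h3]
  exact hadm

/-- **`∑_y μ'_z(y)² ≤ 1[z admissible] · (H(n₁,n₂)/max(n₁,n₂) + 1) H²`.** [folklore] -/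
theorem sum_sq_muB_le {A m K H N : ℕ} (hA : 1 ≤ A) {z : ℕ × (ℕ × ℕ)} (hz : z ∈ L6.Zset K N)
    (Y : Finset (ℕ × ℕ)) :
    ∑ y ∈ Y, ((muB A m K H N z y : ℕ) : ℝ) ^ 2 ≤
      if admZ m z then ((H : ℝ) * (Nat.gcd z.2.1 z.2.2 : ℕ) / ((max z.2.1 z.2.2 : ℕ) : ℝ) + 1) * (H : ℝ) ^ 2
      else 0 := by
  split_ifs with h
  · refine le_trans (Finset.sum_le_sum fun y _ => ?_) (L6.sum_sq_mu_le hA hz Y)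
    have := muB_le_mu A m K H N z y
    exact pow_le_pow_left₀ (Nat.cast_nonneg _) (by exact_mod_cast this) 2
  · refine le_of_eq (Finset.sum_eq_zero fun y _ => ?_)
    rw [muB_eq_zero_of_not_admZ h y]
    simp

/-- **`∑_{y ∈ Y} |B(y)|² ≤ T_l T_r ∑_{z admissible} (H(n₁,n₂)/max + 1) H² (b_{n₁} b_{n₂})²`** over any
box `Y` of keys `(l, r)` with `l, r ≥ 1` on which `τ(l) ≤ T_l`, `τ(r) ≤ T_r`. [cite: BombieriFriedlanderIwaniecActa1986, §9 p. 231] -/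
theorem sum_norm_sq_BcoefB_le {A m K H N : ℕ} (hA : 1 ≤ A) {b : ℕ → ℝ} {β : ℕ → ℕ → ℂ}
    (hβ : ∀ h n, ‖β h n‖ ≤ |b n|) (Y : Finset (ℕ × ℕ)) {Tn Tr : ℝ} (hTn0 : 0 ≤ Tn) (hTr0 : 0 ≤ Tr)
    (hTn : ∀ y ∈ Y, (#y.1.divisors : ℝ) ≤ Tn) (hTr : ∀ y ∈ Y, (#y.2.divisors : ℝ) ≤ Tr)
    (hY : ∀ y ∈ Y, y.1 ≠ 0 ∧ y.2 ≠ 0) :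
    ∑ y ∈ Y, ‖BcoefB A m β K H N y‖ ^ 2 ≤
      Tn * Tr * ∑ z ∈ L6.Zset K N,
        (if admZ m z then ((H : ℝ) * (Nat.gcd z.2.1 z.2.2 : ℕ) / ((max z.2.1 z.2.2 : ℕ) : ℝ) + 1) * (H : ℝ) ^ 2
          else 0) * bz b z ^ 2 := by
  have h1 : ∀ y ∈ Y, ‖BcoefB A m β K H N y‖ ^ 2 ≤
      Tn * Tr * ∑ z ∈ L6.Zset K N, ((muB A m K H N z y : ℝ)) ^ 2 * bz b z ^ 2 := by
    intro y hy
    refine (norm_sq_BcoefB_le A m hβ K H N (hY y hy).1 (hY y hy).2).trans ?_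
    have e : ∑ z ∈ L6.Zset K N, ((muB A m K H N z y : ℝ) * bz b z) ^ 2 =
        ∑ z ∈ L6.Zset K N, ((muB A m K H N z y : ℝ)) ^ 2 * bz b z ^ 2 :=
      Finset.sum_congr rfl fun z _ => by ring
    rw [e]
    refine mul_le_mul_of_nonneg_right ?_ (Finset.sum_nonneg fun _ _ => by positivity)
    push_cast
    exact mul_le_mul (hTn y hy) (hTr y hy) (Nat.cast_nonneg _) hTn0
  calc ∑ y ∈ Y, ‖BcoefB A m β K H N y‖ ^ 2
      ≤ ∑ y ∈ Y, Tn * Tr * ∑ z ∈ L6.Zset K N, ((muB A m K H N z y : ℝ)) ^ 2 * bz b z ^ 2 :=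
        Finset.sum_le_sum h1
    _ = Tn * Tr * ∑ z ∈ L6.Zset K N, (∑ y ∈ Y, ((muB A m K H N z y : ℝ)) ^ 2) * bz b z ^ 2 := by
        rw [← Finset.mul_sum, Finset.sum_comm]
        congr 1
        refine Finset.sum_congr rfl fun z _ => ?_
        rw [Finset.sum_mul]
    _ ≤ Tn * Tr * ∑ z ∈ L6.Zset K N,
          (if admZ m z then ((H : ℝ) * (Nat.gcd z.2.1 z.2.2 : ℕ) / ((max z.2.1 z.2.2 : ℕ) : ℝ) + 1) * (H : ℝ) ^ 2
            else 0) * bz b z ^ 2 := by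
        have hTT : 0 ≤ Tn * Tr := mul_nonneg hTn0 hTr0
        refine mul_le_mul_of_nonneg_left (Finset.sum_le_sum fun z hz => ?_) hTT
        exact mul_le_mul_of_nonneg_right (sum_sq_muB_le hA hz Y) (sq_nonneg _)


/-- `(|b_{n₁}||b_{n₂}|)² = b_{n₁}² b_{n₂}²`. [folklore] -/
theorem bz_sq (b : ℕ → ℝ) (z : ℕ × (ℕ × ℕ)) : bz b z ^ 2 = b z.2.1 ^ 2 * b z.2.2 ^ 2 := by
  rw [bz, mul_pow, sq_abs, sq_abs]

/-- **The number of admissible `k ≤ K` for given `n₁, n₂ ≤ N`**: at most `K` if `n₁ = n₂`, and at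
most `τ(|n₁ − n₂|) ≤ T` otherwise. [folklore] -/
theorem card_filter_admZ_le (m K : ℕ) {N : ℕ} {T : ℝ} (hT0 : 0 ≤ T)
    (hT : ∀ d : ℕ, 1 ≤ d → d ≤ N → (#d.divisors : ℝ) ≤ T) {n₁ n₂ : ℕ} (hn₁ : n₁ ∈ Icc 1 N)
    (hn₂ : n₂ ∈ Icc 1 N) :
    (#((Icc 1 K).filter (fun k => admZ m (k, (n₁, n₂)))) : ℝ) ≤ (if n₁ = n₂ then (K : ℝ) else 0) + T := by
  rw [Finset.mem_Icc] at hn₁ hn₂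
  by_cases h : n₁ = n₂
  · rw [if_pos h]
    have : #((Icc 1 K).filter (fun k => admZ m (k, (n₁, n₂)))) ≤ K := by
      refine (Finset.card_filter_le _ _).trans ?_
      rw [Nat.card_Icc, add_tsub_cancel_right]
    have : (#((Icc 1 K).filter (fun k => admZ m (k, (n₁, n₂)))) : ℝ) ≤ K := by exact_mod_cast this
    linarith
  · rw [if_neg h, zero_add]
    have h1 : #((Icc 1 K).filter (fun k => admZ m (k, (n₁, n₂)))) ≤
        #((Icc 1 K).filter (fun k => n₁ ≡ n₂ [MOD m * k])) := by
      refine Finset.card_le_card fun k hk => ?_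
      rw [Finset.mem_filter] at hk ⊢
      exact ⟨hk.1, hk.2.2⟩
    have h2 := card_filter_modEq_le h m K
    have hd1 : 1 ≤ Int.natAbs ((n₁ : ℤ) - n₂) := by omega
    have hdN : Int.natAbs ((n₁ : ℤ) - n₂) ≤ N := by omega
    calc (#((Icc 1 K).filter (fun k => admZ m (k, (n₁, n₂)))) : ℝ)
        ≤ #(Int.natAbs ((n₁ : ℤ) - n₂)).divisors := by exact_mod_cast h1.trans h2
      _ ≤ T := hT _ hd1 hdN

/-- **The `z`-sum behind `‖B‖²`**: with `S₄ = ∑ b_n⁴`,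
`∑_{z adm} (H(n₁,n₂)/max + 1) H² (b_{n₁}b_{n₂})² ≤ H² {K(H+1) S₄ + T (H (1+log N) ∑ τ(n) b_n⁴ + N S₄)}`.
[cite: BombieriFriedlanderIwaniecActa1986, §9 (9.18) p. 231] -/
theorem zsum_le (m K H N : ℕ) (b : ℕ → ℝ) {T : ℝ} (hT0 : 0 ≤ T)
    (hT : ∀ d : ℕ, 1 ≤ d → d ≤ N → (#d.divisors : ℝ) ≤ T) :
    ∑ z ∈ L6.Zset K N,
        (if admZ m z then ((H : ℝ) * (Nat.gcd z.2.1 z.2.2 : ℕ) / ((max z.2.1 z.2.2 : ℕ) : ℝ) + 1) * (H : ℝ) ^ 2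
          else 0) * bz b z ^ 2 ≤
      (H : ℝ) ^ 2 * (K * (H + 1) * ∑ n ∈ Icc 1 N, b n ^ 4 +
        T * (H * ((1 + Real.log N) * ∑ n ∈ Icc 1 N, (#n.divisors : ℝ) * b n ^ 4) +
          N * ∑ n ∈ Icc 1 N, b n ^ 4)) := by
  set w : ℕ → ℕ → ℝ := fun n₁ n₂ =>
    (H : ℝ) * (Nat.gcd n₁ n₂ : ℕ) / ((max n₁ n₂ : ℕ) : ℝ) + 1 with hw
  have hw0 : ∀ n₁ n₂, 0 ≤ w n₁ n₂ := fun n₁ n₂ => by rw [hw]; positivity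
  set v : ℕ → ℕ → ℝ := fun n₁ n₂ => b n₁ ^ 2 * b n₂ ^ 2 with hv
  have hv0 : ∀ n₁ n₂, 0 ≤ v n₁ n₂ := fun n₁ n₂ => by rw [hv]; positivity
  -- step 1: write the `z`-sum as `∑_{n₁,n₂} (w H² v) · ♯{k admissible}`
  have h1 : ∑ z ∈ L6.Zset K N,
      (if admZ m z then ((H : ℝ) * (Nat.gcd z.2.1 z.2.2 : ℕ) / ((max z.2.1 z.2.2 : ℕ) : ℝ) + 1) * (H : ℝ) ^ 2
        else 0) * bz b z ^ 2 =
      ∑ n₁ ∈ Icc 1 N, ∑ n₂ ∈ Icc 1 N, (w n₁ n₂ * (H : ℝ) ^ 2 * v n₁ n₂) *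
        (#((Icc 1 K).filter (fun k => admZ m (k, (n₁, n₂)))) : ℝ) := by
    rw [L6.Zset, Finset.sum_product]
    simp_rw [Finset.sum_product]
    simp only [bz_sq]
    rw [Finset.sum_comm]
    refine Finset.sum_congr rfl fun n₁ _ => ?_
    rw [Finset.sum_comm]
    refine Finset.sum_congr rfl fun n₂ _ => ?_
    simp_rw [ite_mul, zero_mul]
    rw [← Finset.sum_filter, Finset.sum_const, nsmul_eq_mul, mul_comm]
  rw [h1]
  -- step 2: the `k`-count
  have h2 : ∑ n₁ ∈ Icc 1 N, ∑ n₂ ∈ Icc 1 N, (w n₁ n₂ * (H : ℝ) ^ 2 * v n₁ n₂) *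
        (#((Icc 1 K).filter (fun k => admZ m (k, (n₁, n₂)))) : ℝ) ≤
      ∑ n₁ ∈ Icc 1 N, ∑ n₂ ∈ Icc 1 N, (w n₁ n₂ * (H : ℝ) ^ 2 * v n₁ n₂) *
        ((if n₁ = n₂ then (K : ℝ) else 0) + T) := by
    refine Finset.sum_le_sum fun n₁ hn₁ => Finset.sum_le_sum fun n₂ hn₂ => ?_
    refine mul_le_mul_of_nonneg_left (card_filter_admZ_le m K hT0 hT hn₁ hn₂) ?_
    exact mul_nonneg (mul_nonneg (hw0 _ _) (sq_nonneg _)) (hv0 _ _)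
  refine h2.trans ?_
  -- step 3: split into the diagonal `n₁ = n₂` and the full double sum
  have h3 : ∑ n₁ ∈ Icc 1 N, ∑ n₂ ∈ Icc 1 N, (w n₁ n₂ * (H : ℝ) ^ 2 * v n₁ n₂) *
        ((if n₁ = n₂ then (K : ℝ) else 0) + T) =
      (H : ℝ) ^ 2 * (K * ∑ n ∈ Icc 1 N, w n n * v n n +
        T * ∑ n₁ ∈ Icc 1 N, ∑ n₂ ∈ Icc 1 N, w n₁ n₂ * v n₁ n₂) := by
    have e : ∀ n₁ n₂ : ℕ, (w n₁ n₂ * (H : ℝ) ^ 2 * v n₁ n₂) * ((if n₁ = n₂ then (K : ℝ) else 0) + T) =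
        (if n₁ = n₂ then (H : ℝ) ^ 2 * K * (w n₁ n₂ * v n₁ n₂) else 0) +
          (H : ℝ) ^ 2 * T * (w n₁ n₂ * v n₁ n₂) := by
      intro n₁ n₂
      split_ifs <;> ring
    simp_rw [e, Finset.sum_add_distrib, Finset.sum_ite_eq]
    rw [mul_add]
    congr 1
    · rw [← mul_assoc, Finset.mul_sum]
      refine Finset.sum_congr rfl fun n hn => ?_
      rw [if_pos hn]
    · rw [← mul_assoc, Finset.mul_sum]
      refine Finset.sum_congr rfl fun n₁ _ => ?_
      rw [Finset.mul_sum]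
  rw [h3]
  refine mul_le_mul_of_nonneg_left ?_ (sq_nonneg _)
  -- step 4: the diagonal `w(n,n) = H + 1`, `v(n,n) = b_n⁴`
  have h4 : ∑ n ∈ Icc 1 N, w n n * v n n = (H + 1) * ∑ n ∈ Icc 1 N, b n ^ 4 := by
    rw [Finset.mul_sum]
    refine Finset.sum_congr rfl fun n hn => ?_
    have hn0 : (0 : ℝ) < n := by exact_mod_cast (Finset.mem_Icc.1 hn).1
    rw [hw, hv]
    simp only [Nat.gcd_self, max_self]
    field_simp
  -- step 5: the full double sum
  have h5 : ∑ n₁ ∈ Icc 1 N, ∑ n₂ ∈ Icc 1 N, w n₁ n₂ * v n₁ n₂ ≤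
      H * ((1 + Real.log N) * ∑ n ∈ Icc 1 N, (#n.divisors : ℝ) * b n ^ 4) +
        N * ∑ n ∈ Icc 1 N, b n ^ 4 := by
    have e : ∑ n₁ ∈ Icc 1 N, ∑ n₂ ∈ Icc 1 N, w n₁ n₂ * v n₁ n₂ =
        H * ∑ n₁ ∈ Icc 1 N, ∑ n₂ ∈ Icc 1 N,
          (((Nat.gcd n₁ n₂ : ℕ) : ℝ) / ((max n₁ n₂ : ℕ) : ℝ)) * (b n₁ ^ 2 * b n₂ ^ 2) +
          (∑ n ∈ Icc 1 N, b n ^ 2) ^ 2 := by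
      rw [sq, Finset.sum_mul_sum, Finset.mul_sum, ← Finset.sum_add_distrib]
      refine Finset.sum_congr rfl fun n₁ _ => ?_
      rw [Finset.mul_sum, ← Finset.sum_add_distrib]
      refine Finset.sum_congr rfl fun n₂ _ => ?_
      rw [hw, hv]
      ring
    rw [e]
    have hgcd : ∑ n₁ ∈ Icc 1 N, ∑ n₂ ∈ Icc 1 N,
        (((Nat.gcd n₁ n₂ : ℕ) : ℝ) / ((max n₁ n₂ : ℕ) : ℝ)) * (b n₁ ^ 2 * b n₂ ^ 2) ≤
        (1 + Real.log N) * ∑ n ∈ Icc 1 N, (#n.divisors : ℝ) * b n ^ 4 := by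
      refine (sum_sum_symm_weight_le N (fun _ _ => by positivity)
        (fun a c => by rw [Nat.gcd_comm, max_comm]) (fun n => b n ^ 2)).trans ?_
      rw [Finset.mul_sum]
      refine Finset.sum_le_sum fun n₁ hn₁ => ?_
      have hn₁0 : n₁ ≠ 0 := by have := (Finset.mem_Icc.1 hn₁).1; omega
      have := sum_gcd_div_max_le hn₁0 N
      have hb : 0 ≤ (b n₁ ^ 2) ^ 2 := sq_nonneg _
      calc (b n₁ ^ 2) ^ 2 * ∑ n₂ ∈ Icc 1 N, ((Nat.gcd n₁ n₂ : ℕ) : ℝ) / ((max n₁ n₂ : ℕ) : ℝ)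
          ≤ (b n₁ ^ 2) ^ 2 * ((#n₁.divisors : ℝ) * (1 + Real.log N)) :=
            mul_le_mul_of_nonneg_left this hb
        _ = (1 + Real.log N) * ((#n₁.divisors : ℝ) * b n₁ ^ 4) := by ring
    have hsq : (∑ n ∈ Icc 1 N, b n ^ 2) ^ 2 ≤ N * ∑ n ∈ Icc 1 N, b n ^ 4 := by
      have := sq_sum_Icc_le N (fun n => b n ^ 2)
      refine this.trans (le_of_eq ?_)
      congr 1
      refine Finset.sum_congr rfl fun n _ => ?_
      ring
    have hH0 : (0 : ℝ) ≤ H := Nat.cast_nonneg _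
    nlinarith [mul_le_mul_of_nonneg_left hgcd hH0]
  have hS0 : 0 ≤ ∑ n ∈ Icc 1 N, b n ^ 4 := Finset.sum_nonneg fun n _ => by positivity
  rw [h4]
  have hK0 : (0 : ℝ) ≤ K := Nat.cast_nonneg _
  nlinarith [mul_le_mul_of_nonneg_left h5 hT0]

/-- `∑ b_n⁴ ≤ ∑ ϱ(n) b_n⁴` (`ϱ ≥ 1`). [folklore] -/
theorem sum_pow_four_le_sum_rho (N : ℕ) (b : ℕ → ℝ) :
    ∑ n ∈ Icc 1 N, b n ^ 4 ≤ ∑ n ∈ Icc 1 N, (rho n : ℝ) * b n ^ 4 := by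
  refine Finset.sum_le_sum fun n hn => ?_
  have hn0 : n ≠ 0 := by have := (Finset.mem_Icc.1 hn).1; omega
  have h1 : (1 : ℝ) ≤ rho n := by exact_mod_cast one_le_rho hn0
  have hb : 0 ≤ b n ^ 4 := by positivity
  nlinarith

/-- `∑ τ(n) b_n⁴ ≤ ∑ ϱ(n) b_n⁴` (`τ ≤ ϱ`). [folklore] -/
theorem sum_tau_pow_four_le_sum_rho (N : ℕ) (b : ℕ → ℝ) :
    ∑ n ∈ Icc 1 N, (#n.divisors : ℝ) * b n ^ 4 ≤ ∑ n ∈ Icc 1 N, (rho n : ℝ) * b n ^ 4 :=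
  Finset.sum_le_sum fun n _ => mul_le_mul_of_nonneg_right (card_divisors_le_rho n) (by positivity)

/-- The elementary inequality gathering the three terms of `‖B‖²`:
`K(H+1)S₄ + T(H L S_τ + N S₄) ≤ 3 T L (HK + N) S_ϱ`. [folklore] -/
theorem moments_ineq {K H N T L S₄ Sτ Sρ : ℝ} (hK : 1 ≤ K) (hH : 1 ≤ H) (hN : 0 ≤ N) (hT : 1 ≤ T)
    (hL : 1 ≤ L) (hS₄0 : 0 ≤ S₄) (hSτ0 : 0 ≤ Sτ) (hS₄ρ : S₄ ≤ Sρ) (hSτρ : Sτ ≤ Sρ) :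
    K * (H + 1) * S₄ + T * (H * (L * Sτ) + N * S₄) ≤ 3 * T * L * (H * K + N) * Sρ := by
  have hT0 : 0 ≤ T := by linarith
  have hL0 : 0 ≤ L := by linarith
  have hH0 : 0 ≤ H := by linarith
  have hK0 : 0 ≤ K := by linarith
  have hSρ0 : 0 ≤ Sρ := hS₄0.trans hS₄ρ
  have hTL : 1 ≤ T * L := one_le_mul_of_one_le_of_one_le hT hL
  have hTL0 : 0 ≤ T * L := by linarith
  -- term 1: `K(H+1)S₄ ≤ 2KH · TLSρ`
  have e11 : S₄ ≤ T * L * Sρ := by nlinarith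
  have t1 : K * (H + 1) * S₄ ≤ 2 * (K * H * (T * L * Sρ)) := by
    have e1 : K * (H + 1) ≤ 2 * (K * H) := by nlinarith
    have e0 : 0 ≤ K * (H + 1) := by positivity
    calc K * (H + 1) * S₄ ≤ K * (H + 1) * (T * L * Sρ) := mul_le_mul_of_nonneg_left e11 e0
      _ ≤ 2 * (K * H) * (T * L * Sρ) := mul_le_mul_of_nonneg_right e1 (by positivity)
      _ = 2 * (K * H * (T * L * Sρ)) := by ring
  -- term 2: `T H L Sτ ≤ HK · TLSρ`
  have t2 : T * (H * (L * Sτ)) ≤ K * H * (T * L * Sρ) := by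
    have e1 : L * Sτ ≤ L * Sρ := mul_le_mul_of_nonneg_left hSτρ hL0
    have e2 : H ≤ H * K := le_mul_of_one_le_right hH0 hK
    have e3 : H * (L * Sτ) ≤ (H * K) * (L * Sρ) := mul_le_mul e2 e1 (by positivity) (by positivity)
    calc T * (H * (L * Sτ)) ≤ T * ((H * K) * (L * Sρ)) := mul_le_mul_of_nonneg_left e3 hT0
      _ = K * H * (T * L * Sρ) := by ring
  -- term 3: `T N S₄ ≤ N · TLSρ`
  have t3 : T * (N * S₄) ≤ N * (T * L * Sρ) := by
    have e2 : S₄ ≤ L * Sρ := by nlinarith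
    have e3 : N * S₄ ≤ N * (L * Sρ) := mul_le_mul_of_nonneg_left e2 hN
    calc T * (N * S₄) ≤ T * (N * (L * Sρ)) := mul_le_mul_of_nonneg_left e3 hT0
      _ = N * (T * L * Sρ) := by ring
  have h0 : 0 ≤ N * (T * L * Sρ) := by positivity
  have e : 3 * T * L * (H * K + N) * Sρ = 3 * (K * H * (T * L * Sρ)) + 3 * (N * (T * L * Sρ)) := by ring
  rw [e]
  linarith

/-- **The bound (9.18) for `‖B‖²`** (BFI p. 231: "`‖B‖² ≪ (HKN)^ε H²(HK + N) ∑_n ϱ(n)|β_n|⁴`"), over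
any box `Y` of keys `(l, r)`, `l, r ≥ 1`, on which `τ(l) ≤ T_l`, `τ(r) ≤ T_r`, and with `τ(d) ≤ T`
for `d ≤ N`:
`∑_{y ∈ Y} |B(y)|² ≤ 3 T_l T_r T (1 + log N) · H²(HK + N) ∑_{n ≤ N} ϱ(n) b_n⁴`.
[cite: BombieriFriedlanderIwaniecActa1986, §9 (9.18) p. 231] -/
theorem boxsumB_le {A m K H N : ℕ} (hA : 1 ≤ A) (hK : 1 ≤ K) (hH : 1 ≤ H) {b : ℕ → ℝ}
    {β : ℕ → ℕ → ℂ} (hβ : ∀ h n, ‖β h n‖ ≤ |b n|) (Y : Finset (ℕ × ℕ)) {Tn Tr T : ℝ}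
    (hTn0 : 0 ≤ Tn) (hTr0 : 0 ≤ Tr) (hT1 : 1 ≤ T)
    (hTn : ∀ y ∈ Y, (#y.1.divisors : ℝ) ≤ Tn) (hTr : ∀ y ∈ Y, (#y.2.divisors : ℝ) ≤ Tr)
    (hY : ∀ y ∈ Y, y.1 ≠ 0 ∧ y.2 ≠ 0) (hT : ∀ d : ℕ, 1 ≤ d → d ≤ N → (#d.divisors : ℝ) ≤ T) :
    ∑ y ∈ Y, ‖BcoefB A m β K H N y‖ ^ 2 ≤
      3 * Tn * Tr * T * (1 + Real.log N) * ((H : ℝ) ^ 2 * (H * K + N)) *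
        ∑ n ∈ Icc 1 N, (rho n : ℝ) * b n ^ 4 := by
  have hT0 : 0 ≤ T := zero_le_one.trans hT1
  have h1 := sum_norm_sq_BcoefB_le (A := A) (m := m) (K := K) (H := H) (N := N) hA hβ Y hTn0 hTr0 hTn hTr hY
  have h2 := zsum_le m K H N b hT0 hT
  refine h1.trans ((mul_le_mul_of_nonneg_left h2 (mul_nonneg hTn0 hTr0)).trans ?_)
  have hL1 : 1 ≤ 1 + Real.log N := by have := Real.log_natCast_nonneg N; linarith
  have hK' : (1 : ℝ) ≤ K := by exact_mod_cast hK
  have hH' : (1 : ℝ) ≤ H := by exact_mod_cast hH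
  have hS₄0 : 0 ≤ ∑ n ∈ Icc 1 N, b n ^ 4 := Finset.sum_nonneg fun n _ => by positivity
  have hSτ0 : 0 ≤ ∑ n ∈ Icc 1 N, (#n.divisors : ℝ) * b n ^ 4 :=
    Finset.sum_nonneg fun n _ => by positivity
  have key := moments_ineq hK' hH' (Nat.cast_nonneg N) hT1 hL1 hS₄0 hSτ0
    (sum_pow_four_le_sum_rho N b) (sum_tau_pow_four_le_sum_rho N b)
  have hH2 : 0 ≤ (H : ℝ) ^ 2 := sq_nonneg _
  calc Tn * Tr * ((H : ℝ) ^ 2 * (K * (H + 1) * ∑ n ∈ Icc 1 N, b n ^ 4 +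
        T * (H * ((1 + Real.log N) * ∑ n ∈ Icc 1 N, (#n.divisors : ℝ) * b n ^ 4) +
          N * ∑ n ∈ Icc 1 N, b n ^ 4)))
      ≤ Tn * Tr * ((H : ℝ) ^ 2 * (3 * T * (1 + Real.log N) * (H * K + N) *
          ∑ n ∈ Icc 1 N, (rho n : ℝ) * b n ^ 4)) :=
        mul_le_mul_of_nonneg_left (mul_le_mul_of_nonneg_left key hH2) (mul_nonneg hTn0 hTr0)
    _ = _ := by ring


/-! ### One smoothed block, from Lemma 1 -/

/-- **One smoothed block, from Lemma 1** (BFI p. 230–231): for the weight `g(c,d) = w(c/C')w(d/D')`,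
`blockB ≤ (5C'/4)(5D'/4) · KH(1 + log N) ∑ τ(n) b_n² + 2 ∑_{l ≤ L} K₁ (C'D'N_𝓚R_l S)^ε 𝓘(C',D',N_𝓚,R_l,S) ‖B‖_box`
with `N_𝓚 = AKHN`, `R_l = 2^l/2`, `S = 1/2`, `2^L ≥ N²`, where `K₁ ≥ 0` is the constant of Lemma 1 for
the weight `w ⊗ w` at the exponent `ε`. [cite: BombieriFriedlanderIwaniecActa1986, §9 (9.16)–(9.17) p. 230] -/
theorem blockB_le_of_K1 {ε K₁ : ℝ} (hK₁0 : 0 ≤ K₁)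
    (hK₁ : ∀ C' D' N R S : ℝ, 1 ≤ C' → 1 ≤ D' → 1 ≤ N → 1 / 2 ≤ R → 1 / 2 ≤ S →
      ∀ B : ℕ → ℕ → ℕ → ℂ,
        ‖dispK (fun c d => plateau2 (c / C') (d / D')) ⌊5 / 4 * C'⌋₊ ⌊5 / 4 * D'⌋₊ ⌊N⌋₊ R S B‖ ≤
          K₁ * (C' * D' * N * R * S) ^ ε * lemma1I C' D' N R S * lemma1Norm ⌊N⌋₊ R S B)
    {A m K H N : ℕ} (hA : 1 ≤ A) (hm : 0 < m) (hK : 1 ≤ K) (hH : 1 ≤ H) (hN : 1 ≤ N)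
    {C' D' : ℝ} (hC' : 1 ≤ C') (hD' : 1 ≤ D') {b : ℕ → ℝ} {β : ℕ → ℕ → ℂ}
    (hβ : ∀ h n, ‖β h n‖ ≤ |b n|) {L : ℕ} (hL : N * N ≤ 2 ^ L) :
    blockB (A : ℤ) m (fun c d => plateau2 (c / C') (d / D')) ⌊5 / 4 * C'⌋₊ ⌊5 / 4 * D'⌋₊ K H N β ≤
      ((⌊5 / 4 * C'⌋₊ : ℝ) * ⌊5 / 4 * D'⌋₊) *
          (K * H * (1 + Real.log N) * ∑ n ∈ Icc 1 N, (#n.divisors : ℝ) * b n ^ 2) +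
        2 * ∑ l ∈ Finset.range (L + 1),
          K₁ * (C' * D' * ((A * K * (H * N) : ℕ) : ℝ) * ((2 : ℝ) ^ l / 2) * (1 / 2)) ^ ε *
            lemma1I C' D' ((A * K * (H * N) : ℕ) : ℝ) ((2 : ℝ) ^ l / 2) (1 / 2) *
            Real.sqrt (∑ y ∈ Icc 1 (A * K * (H * N)) ×ˢ Icc 1 (2 ^ L),
              ‖BcoefB A m β K H N y‖ ^ 2) := by
  set g : ℕ → ℕ → ℝ := fun c d => plateau2 (c / C') (d / D') with hg
  have hg0 : ∀ c d, 0 ≤ g c d := fun c d => plateau2_nonneg _ _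
  set cM : ℕ := ⌊5 / 4 * C'⌋₊
  set dM : ℕ := ⌊5 / 4 * D'⌋₊
  set Nmax : ℕ := A * K * (H * N) with hNmax
  have hN1 : (1 : ℝ) ≤ (Nmax : ℝ) := by
    have : 1 ≤ Nmax := by
      have h1 : 1 * 1 ≤ A * K := Nat.mul_le_mul hA hK
      have h2 : 1 * 1 ≤ H * N := Nat.mul_le_mul hH hN
      have h3 : 1 * 1 ≤ (A * K) * (H * N) := Nat.mul_le_mul (by simpa using h1) (by simpa using h2)
      simpa [hNmax] using h3
    exact_mod_cast this
  -- the two parts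
  have hparts := blockB_le_parts (A : ℤ) hm g cM dM K H N β
  have hZ0 := diag_le (A : ℤ) m hg0 cM dM K H N hβ
  have hG : ∑ c ∈ Icc 1 cM, ∑ d ∈ Icc 1 dM, g c d ≤ (cM : ℝ) * dM :=
    L6.sum_sum_plateau2_le C' D' cM dM
  have hZpos : ‖L6.Zpart (tsetBPos m K H N) (A : ℤ) g cM dM β‖ ≤
      ∑ l ∈ Finset.range (L + 1),
        K₁ * (C' * D' * (Nmax : ℝ) * ((2 : ℝ) ^ l / 2) * (1 / 2)) ^ ε *
          lemma1I C' D' (Nmax : ℝ) ((2 : ℝ) ^ l / 2) (1 / 2) *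
          Real.sqrt (∑ y ∈ Icc 1 Nmax ×ˢ Icc 1 (2 ^ L), ‖BcoefB A m β K H N y‖ ^ 2) := by
    rw [Zpart_pos_eq_sum_dispK hA m g cM dM K H N β hL]
    refine (norm_sum_le _ _).trans (Finset.sum_le_sum fun l hl => ?_)
    have hlL : l ≤ L := Nat.lt_succ_iff.1 (Finset.mem_range.1 hl)
    have hR : (1 : ℝ) / 2 ≤ (2 : ℝ) ^ l / 2 := by
      have : (1 : ℝ) ≤ (2 : ℝ) ^ l := one_le_pow₀ (by norm_num)
      linarith
    have h := hK₁ C' D' (Nmax : ℝ) ((2 : ℝ) ^ l / 2) (1 / 2) hC' hD' hN1 hR le_rfl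
      (fun n r _ => BcoefB A m β K H N (n, r))
    rw [Nat.floor_natCast] at h
    refine h.trans ?_
    refine mul_le_mul_of_nonneg_left (L6.lemma1Norm_block_le Nmax hlL _) ?_
    have : 0 ≤ lemma1I C' D' (Nmax : ℝ) ((2 : ℝ) ^ l / 2) (1 / 2) := Real.sqrt_nonneg _
    positivity
  have hdiag0 : 0 ≤ (K : ℝ) * H * (1 + Real.log N) * ∑ n ∈ Icc 1 N, (#n.divisors : ℝ) * b n ^ 2 := by
    have : 0 ≤ 1 + Real.log N := by have := Real.log_natCast_nonneg N; linarith
    exact mul_nonneg (by positivity) (Finset.sum_nonneg fun n _ => by positivity)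
  calc blockB (A : ℤ) m g cM dM K H N β
      ≤ ‖L6.Zpart (tsetBZero m K H N) (A : ℤ) g cM dM β‖ +
          2 * ‖L6.Zpart (tsetBPos m K H N) (A : ℤ) g cM dM β‖ := hparts
    _ ≤ ((cM : ℝ) * dM) * (K * H * (1 + Real.log N) * ∑ n ∈ Icc 1 N, (#n.divisors : ℝ) * b n ^ 2) +
        2 * ∑ l ∈ Finset.range (L + 1),
          K₁ * (C' * D' * (Nmax : ℝ) * ((2 : ℝ) ^ l / 2) * (1 / 2)) ^ ε *
            lemma1I C' D' (Nmax : ℝ) ((2 : ℝ) ^ l / 2) (1 / 2) *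
            Real.sqrt (∑ y ∈ Icc 1 Nmax ×ˢ Icc 1 (2 ^ L), ‖BcoefB A m β K H N y‖ ^ 2) := by
        have h1 : ‖L6.Zpart (tsetBZero m K H N) (A : ℤ) g cM dM β‖ ≤
            ((cM : ℝ) * dM) * (K * H * (1 + Real.log N) * ∑ n ∈ Icc 1 N, (#n.divisors : ℝ) * b n ^ 2) :=
          hZ0.trans (mul_le_mul_of_nonneg_right hG hdiag0)
        linarith

/-! ### Covering `[1, C] × [1, D]` by smoothed dyadic blocks -/

/-- `𝓑_m` with natural-number parameters `H, N` inside. [folklore] -/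
theorem dispBm_eq_sum (a : ℤ) (m : ℕ) (C D K H N : ℝ) (β : ℕ → ℕ → ℂ) :
    dispBm a m C D K H N β = ∑ c ∈ Icc 1 ⌊C⌋₊, ∑ d ∈ Icc 1 ⌊D⌋₊,
      ∑ k ∈ Icc 1 ⌊K⌋₊, ((Nat.totient (m * k) : ℝ))⁻¹ *
        ∑ χ : DirichletCharacter ℂ (m * k), ‖bInner a m ((⌊H⌋₊ : ℕ) : ℝ) ((⌊N⌋₊ : ℕ) : ℝ) β c d k χ‖ ^ 2 := by
  unfold dispBm bInner
  simp only [Nat.floor_natCast]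

/-- **`𝓑_m ≤ ∑_{i ≤ I} ∑_{j ≤ J} blockB_{ij}`**: the sharp cut-offs `c ≤ C`, `d ≤ D` are majorised by
the sum of the smooth dyadic plateaus (all terms of `𝓑_m` being `≥ 0`), BFI p. 230: "As before it
suffices to prove the result for a sum modified by a smooth weight function `g(c, d)`".
[cite: BombieriFriedlanderIwaniecActa1986, §9 p. 230] -/
theorem dispBm_le_sum_blockB (a : ℤ) (m : ℕ) (C D K H N : ℝ) (β : ℕ → ℕ → ℂ) :
    dispBm a m C D K H N β ≤
      ∑ i ∈ Finset.range (Nat.log 2 ⌊C⌋₊ + 1 + 1), ∑ j ∈ Finset.range (Nat.log 2 ⌊D⌋₊ + 1 + 1),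
        blockB a m (fun c d => plateau2 (c / (2 : ℝ) ^ i) (d / (2 : ℝ) ^ j))
          ⌊5 / 4 * (2 : ℝ) ^ i⌋₊ ⌊5 / 4 * (2 : ℝ) ^ j⌋₊ ⌊K⌋₊ ⌊H⌋₊ ⌊N⌋₊ β := by
  rw [dispBm_eq_sum]
  set C₀ := ⌊C⌋₊
  set D₀ := ⌊D⌋₊
  set X : ℕ → ℕ → ℝ := fun c d => ∑ k ∈ Icc 1 ⌊K⌋₊, ((Nat.totient (m * k) : ℝ))⁻¹ *
    ∑ χ : DirichletCharacter ℂ (m * k), ‖bInner a m ((⌊H⌋₊ : ℕ) : ℝ) ((⌊N⌋₊ : ℕ) : ℝ) β c d k χ‖ ^ 2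
    with hX
  have hX0 : ∀ c d, 0 ≤ X c d := fun c d => Finset.sum_nonneg fun _ _ =>
    mul_nonneg (inv_nonneg.2 (Nat.cast_nonneg _)) (Finset.sum_nonneg fun _ _ => by positivity)
  set SI := Finset.range (Nat.log 2 C₀ + 1 + 1)
  set SJ := Finset.range (Nat.log 2 D₀ + 1 + 1)
  -- step 1: insert the covering weights
  have h1 : ∑ c ∈ Icc 1 C₀, ∑ d ∈ Icc 1 D₀, X c d ≤
      ∑ c ∈ Icc 1 C₀, ∑ d ∈ Icc 1 D₀,
        (∑ i ∈ SI, plateau1 ((c : ℝ) / (2 : ℝ) ^ i)) * (∑ j ∈ SJ, plateau1 ((d : ℝ) / (2 : ℝ) ^ j)) * X c d := by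
    refine Finset.sum_le_sum fun c hc => Finset.sum_le_sum fun d hd => ?_
    rw [Finset.mem_Icc] at hc hd
    have hc1 := L6.one_le_sum_plateau hc.1 hc.2
    have hd1 := L6.one_le_sum_plateau hd.1 hd.2
    have : (1 : ℝ) ≤ (∑ i ∈ SI, plateau1 ((c : ℝ) / (2 : ℝ) ^ i)) * (∑ j ∈ SJ, plateau1 ((d : ℝ) / (2 : ℝ) ^ j)) :=
      one_le_mul_of_one_le_of_one_le hc1 hd1
    exact le_mul_of_one_le_left (hX0 c d) this
  -- step 2: expand and reorder
  have h2 : ∑ c ∈ Icc 1 C₀, ∑ d ∈ Icc 1 D₀,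
      (∑ i ∈ SI, plateau1 ((c : ℝ) / (2 : ℝ) ^ i)) * (∑ j ∈ SJ, plateau1 ((d : ℝ) / (2 : ℝ) ^ j)) * X c d =
      ∑ i ∈ SI, ∑ j ∈ SJ, ∑ c ∈ Icc 1 C₀, ∑ d ∈ Icc 1 D₀,
        plateau1 ((c : ℝ) / (2 : ℝ) ^ i) * plateau1 ((d : ℝ) / (2 : ℝ) ^ j) * X c d := by
    simp_rw [Finset.sum_mul_sum, Finset.sum_mul]
    simp_rw [Finset.sum_comm (s := Icc 1 D₀) (t := SI)]
    rw [Finset.sum_comm (s := Icc 1 C₀) (t := SI)]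
    simp_rw [Finset.sum_comm (s := Icc 1 D₀) (t := SJ)]
    simp_rw [Finset.sum_comm (s := Icc 1 C₀) (t := SJ)]
  -- step 3: each `(i, j)`-term is at most `blockB_{ij}`
  have h3 : ∀ i j : ℕ, ∑ c ∈ Icc 1 C₀, ∑ d ∈ Icc 1 D₀,
      plateau1 ((c : ℝ) / (2 : ℝ) ^ i) * plateau1 ((d : ℝ) / (2 : ℝ) ^ j) * X c d ≤
      blockB a m (fun c d => plateau2 (c / (2 : ℝ) ^ i) (d / (2 : ℝ) ^ j))
        ⌊5 / 4 * (2 : ℝ) ^ i⌋₊ ⌊5 / 4 * (2 : ℝ) ^ j⌋₊ ⌊K⌋₊ ⌊H⌋₊ ⌊N⌋₊ β := by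
    intro i j
    unfold blockB plateau2
    have hvan : ∀ (n e : ℕ), ⌊5 / 4 * (2 : ℝ) ^ e⌋₊ < n → plateau1 ((n : ℝ) / (2 : ℝ) ^ e) = 0 := by
      intro n e hn
      have hpow : (0 : ℝ) < (2 : ℝ) ^ e := by positivity
      refine plateau_eq_zero_of_ge ?_
      rw [le_div_iff₀ hpow]
      have := Nat.lt_of_floor_lt hn
      linarith
    calc ∑ c ∈ Icc 1 C₀, ∑ d ∈ Icc 1 D₀,
          plateau1 ((c : ℝ) / (2 : ℝ) ^ i) * plateau1 ((d : ℝ) / (2 : ℝ) ^ j) * X c d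
        ≤ ∑ c ∈ Icc 1 C₀, ∑ d ∈ Icc 1 ⌊5 / 4 * (2 : ℝ) ^ j⌋₊,
          plateau1 ((c : ℝ) / (2 : ℝ) ^ i) * plateau1 ((d : ℝ) / (2 : ℝ) ^ j) * X c d := by
          refine Finset.sum_le_sum fun c _ => ?_
          refine L6.sum_Icc_le_sum_Icc_of_vanish (fun d => ?_) (fun d hd => ?_)
          · exact mul_nonneg (mul_nonneg (plateau_nonneg _) (plateau_nonneg _)) (hX0 c d)
          · rw [hvan d j hd, mul_zero, zero_mul]
      _ ≤ ∑ c ∈ Icc 1 ⌊5 / 4 * (2 : ℝ) ^ i⌋₊, ∑ d ∈ Icc 1 ⌊5 / 4 * (2 : ℝ) ^ j⌋₊,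
          plateau1 ((c : ℝ) / (2 : ℝ) ^ i) * plateau1 ((d : ℝ) / (2 : ℝ) ^ j) * X c d := by
          refine L6.sum_Icc_le_sum_Icc_of_vanish (fun c => ?_) (fun c hc => ?_)
          · exact Finset.sum_nonneg fun d _ =>
              mul_nonneg (mul_nonneg (plateau_nonneg _) (plateau_nonneg _)) (hX0 c d)
          · refine Finset.sum_eq_zero fun d _ => ?_
            rw [hvan c i hc, zero_mul, zero_mul]
      _ = _ := rfl
  calc ∑ c ∈ Icc 1 C₀, ∑ d ∈ Icc 1 D₀, X c d
      ≤ _ := h1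
    _ = _ := h2
    _ ≤ _ := Finset.sum_le_sum fun i _ => Finset.sum_le_sum fun j _ => h3 i j

/-! ### Numerical bounds for the assembly -/

/-- The bracket of (9.15): `C(N²+HKN)(C+DN²) + C²DN√(N²+HKN) + D²HKN³`. [cite: BombieriFriedlanderIwaniecActa1986, §9 (9.15) p. 230] -/
def bracket7 (C D K H N : ℝ) : ℝ :=
  C * (N ^ 2 + H * K * N) * (C + D * N ^ 2) + C ^ 2 * D * N * (N ^ 2 + H * K * N) ^ (1 / 2 : ℝ) +
    D ^ 2 * H * K * N ^ 3

/-- The bracket of (9.15) is `≥ 0`. [folklore] -/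
theorem bracket7_nonneg {C D K H N : ℝ} (hC : 0 ≤ C) (hD : 0 ≤ D) (hK : 0 ≤ K) (hH : 0 ≤ H)
    (hN : 0 ≤ N) : 0 ≤ bracket7 C D K H N := by
  unfold bracket7; positivity

/-- `lemma7Rhs` in terms of `bracket7`. [folklore] -/
theorem lemma7Rhs_eq (C D K H N η S₂ S₄ : ℝ) :
    lemma7Rhs C D K H N η S₂ S₄ =
      (C * D * K * H * N) ^ η * (C * D * H * K * S₂ +
        (bracket7 C D K H N) ^ (1 / 2 : ℝ) * (H ^ 2 * (H * K + N) * S₄) ^ (1 / 2 : ℝ)) := by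
  unfold lemma7Rhs bracket7
  rfl

/-- **`𝓘(C', D', N_𝓚, R, 1/2)² ≤ 16A · bracket`** for `C' ≤ 2C`, `D' ≤ 2D`, `N_𝓚 ≤ AKHN`, `R ≤ 2N²`, `A ≥ 1`.
[cite: BombieriFriedlanderIwaniecActa1986, §9 (9.17) p. 230] -/
theorem lemma1I_sq_le7 {A C D K H N C' D' Nk R : ℝ} (hA : 1 ≤ A) (hC : 1 ≤ C) (hD : 1 ≤ D)
    (hK : 1 ≤ K) (hH : 1 ≤ H) (hN : 1 ≤ N) (hC'0 : 0 ≤ C') (hC' : C' ≤ 2 * C) (hD'0 : 0 ≤ D')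
    (hD' : D' ≤ 2 * D) (hNk0 : 0 ≤ Nk) (hNk : Nk ≤ A * (K * H * N)) (hR0 : 0 ≤ R) (hR : R ≤ 2 * N ^ 2) :
    C' * (1 / 2) * (R * (1 / 2) + Nk) * (C' + D' * R) +
        C' ^ 2 * D' * (1 / 2) * Real.sqrt ((R * (1 / 2) + Nk) * R) + D' ^ 2 * Nk * R / (1 / 2) ≤
      16 * A * bracket7 C D K H N := by
  unfold bracket7
  have hN0 : 0 ≤ N := by linarith
  have hHKN : 0 ≤ H * K * N := by positivity
  have hmid : R * (1 / 2) + Nk ≤ A * (N ^ 2 + H * K * N) := by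
    have : N ^ 2 ≤ A * N ^ 2 := le_mul_of_one_le_left (by positivity) hA
    nlinarith
  have hmid0 : 0 ≤ R * (1 / 2) + Nk := by positivity
  -- term 1
  have h1 : C' * (1 / 2) * (R * (1 / 2) + Nk) * (C' + D' * R) ≤
      4 * A * (C * (N ^ 2 + H * K * N) * (C + D * N ^ 2)) := by
    have e1 : C' + D' * R ≤ 4 * (C + D * N ^ 2) := by
      have : D' * R ≤ 2 * D * (2 * N ^ 2) := mul_le_mul hD' hR hR0 (by linarith)
      nlinarith
    calc C' * (1 / 2) * (R * (1 / 2) + Nk) * (C' + D' * R)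
        ≤ (2 * C) * (1 / 2) * (A * (N ^ 2 + H * K * N)) * (4 * (C + D * N ^ 2)) := by
          gcongr
      _ = 4 * A * (C * (N ^ 2 + H * K * N) * (C + D * N ^ 2)) := by ring
  -- term 2
  have h2 : C' ^ 2 * D' * (1 / 2) * Real.sqrt ((R * (1 / 2) + Nk) * R) ≤
      8 * A * (C ^ 2 * D * N * (N ^ 2 + H * K * N) ^ (1 / 2 : ℝ)) := by
    have e1 : Real.sqrt ((R * (1 / 2) + Nk) * R) ≤ 2 * A * N * Real.sqrt (N ^ 2 + H * K * N) := by
      have : (R * (1 / 2) + Nk) * R ≤ (2 * A * N * Real.sqrt (N ^ 2 + H * K * N)) ^ 2 := by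
        rw [mul_pow, mul_pow, mul_pow, Real.sq_sqrt (by positivity)]
        have hA2 : 2 * A ≤ 4 * A ^ 2 := by nlinarith
        calc (R * (1 / 2) + Nk) * R ≤ (A * (N ^ 2 + H * K * N)) * (2 * N ^ 2) :=
              mul_le_mul hmid hR hR0 (by positivity)
          _ = (2 * A) * N ^ 2 * (N ^ 2 + H * K * N) := by ring
          _ ≤ (4 * A ^ 2) * N ^ 2 * (N ^ 2 + H * K * N) := by gcongr
          _ = 2 ^ 2 * A ^ 2 * N ^ 2 * (N ^ 2 + H * K * N) := by ring
      calc Real.sqrt ((R * (1 / 2) + Nk) * R) ≤ Real.sqrt ((2 * A * N * Real.sqrt (N ^ 2 + H * K * N)) ^ 2) :=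
            Real.sqrt_le_sqrt this
        _ = 2 * A * N * Real.sqrt (N ^ 2 + H * K * N) := Real.sqrt_sq (by positivity)
    have e2 : C' ^ 2 ≤ (2 * C) ^ 2 := pow_le_pow_left₀ hC'0 hC' 2
    rw [← Real.sqrt_eq_rpow]
    calc C' ^ 2 * D' * (1 / 2) * Real.sqrt ((R * (1 / 2) + Nk) * R)
        ≤ (2 * C) ^ 2 * (2 * D) * (1 / 2) * (2 * A * N * Real.sqrt (N ^ 2 + H * K * N)) := by
          gcongr
      _ = 8 * A * (C ^ 2 * D * N * Real.sqrt (N ^ 2 + H * K * N)) := by ring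
  -- term 3
  have h3 : D' ^ 2 * Nk * R / (1 / 2) ≤ 16 * A * (D ^ 2 * H * K * N ^ 3) := by
    have e2 : D' ^ 2 ≤ (2 * D) ^ 2 := pow_le_pow_left₀ hD'0 hD' 2
    calc D' ^ 2 * Nk * R / (1 / 2) = 2 * (D' ^ 2 * Nk * R) := by ring
      _ ≤ 2 * ((2 * D) ^ 2 * (A * (K * H * N)) * (2 * N ^ 2)) := by gcongr
      _ = 16 * A * (D ^ 2 * H * K * N ^ 3) := by ring
  have hb1 : 0 ≤ C * (N ^ 2 + H * K * N) * (C + D * N ^ 2) := by positivity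
  have hb2 : 0 ≤ C ^ 2 * D * N * (N ^ 2 + H * K * N) ^ (1 / 2 : ℝ) := by positivity
  have hb3 : 0 ≤ D ^ 2 * H * K * N ^ 3 := by positivity
  nlinarith

/-- `𝓘(C', D', N_𝓚, R, 1/2) ≤ 4√A · bracket^{1/2}`. [folklore] -/
theorem lemma1I_le7 {A C D K H N C' D' Nk R : ℝ} (hA : 1 ≤ A) (hC : 1 ≤ C) (hD : 1 ≤ D)
    (hK : 1 ≤ K) (hH : 1 ≤ H) (hN : 1 ≤ N) (hC'0 : 0 ≤ C') (hC' : C' ≤ 2 * C) (hD'0 : 0 ≤ D')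
    (hD' : D' ≤ 2 * D) (hNk0 : 0 ≤ Nk) (hNk : Nk ≤ A * (K * H * N)) (hR0 : 0 ≤ R) (hR : R ≤ 2 * N ^ 2) :
    lemma1I C' D' Nk R (1 / 2) ≤ Real.sqrt (16 * A) * (bracket7 C D K H N) ^ (1 / 2 : ℝ) := by
  unfold lemma1I
  rw [← Real.sqrt_eq_rpow, ← Real.sqrt_mul (by linarith)]
  exact Real.sqrt_le_sqrt (lemma1I_sq_le7 hA hC hD hK hH hN hC'0 hC' hD'0 hD' hNk0 hNk hR0 hR)

/-- The `(CDNRS)^ε` factor: `(C'D'N_𝓚 R/2)^ε ≤ (4A)^ε P^{3ε}` with `P = CDKHN`. [folklore] -/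
theorem eps_factor_le7 {A C D K H N C' D' Nk R ε : ℝ} (hA : 1 ≤ A) (hC : 1 ≤ C) (hD : 1 ≤ D)
    (hK : 1 ≤ K) (hH : 1 ≤ H) (hN : 1 ≤ N) (hC'0 : 0 ≤ C') (hC' : C' ≤ 2 * C) (hD'0 : 0 ≤ D')
    (hD' : D' ≤ 2 * D) (hNk0 : 0 ≤ Nk) (hNk : Nk ≤ A * (K * H * N)) (hR0 : 0 ≤ R) (hR : R ≤ 2 * N ^ 2)
    (hε : 0 ≤ ε) :
    (C' * D' * Nk * R * (1 / 2)) ^ ε ≤ (4 * A) ^ ε * (C * D * K * H * N) ^ (3 * ε) := by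
  obtain ⟨hP1, _, _, hKHNP, hNP⟩ := L6.one_le_P hC hD hK hH hN
  set P := C * D * K * H * N with hP
  have hP0 : 0 ≤ P := by linarith
  have hbase : C' * D' * Nk * R * (1 / 2) ≤ 4 * A * P ^ 3 := by
    calc C' * D' * Nk * R * (1 / 2) ≤ (2 * C) * (2 * D) * (A * (K * H * N)) * (2 * N ^ 2) * (1 / 2) := by
          gcongr
      _ = 4 * A * (P * N ^ 2) := by rw [hP]; ring
      _ ≤ 4 * A * (P * P ^ 2) := by
          have : N ^ 2 ≤ P ^ 2 := pow_le_pow_left₀ (by linarith) hNP 2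
          exact mul_le_mul_of_nonneg_left (mul_le_mul_of_nonneg_left this hP0) (by linarith)
      _ = 4 * A * P ^ 3 := by ring
  calc (C' * D' * Nk * R * (1 / 2)) ^ ε ≤ (4 * A * P ^ 3) ^ ε :=
        Real.rpow_le_rpow (by positivity) hbase hε
    _ = (4 * A) ^ ε * (P ^ 3) ^ ε := Real.mul_rpow (by linarith) (by positivity)
    _ = (4 * A) ^ ε * P ^ (3 * ε) := by
        congr 1
        rw [show (P ^ 3 : ℝ) = P ^ ((3 : ℕ) : ℝ) by rw [Real.rpow_natCast], ← Real.rpow_mul hP0]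
        norm_num

/-- `1 + log n ≤ (1 + 1/θ) x^θ` for a natural number `n ≤ x`, `x ≥ 1`, `θ > 0`. [folklore] -/
theorem one_add_log_le_rpow {n : ℕ} {x θ : ℝ} (hx : 1 ≤ x) (hnx : (n : ℝ) ≤ x) (hθ : 0 < θ) :
    1 + Real.log n ≤ (1 + 1 / θ) * x ^ θ := by
  have hxθ : 1 ≤ x ^ θ := Real.one_le_rpow hx hθ.le
  have hlog : Real.log n ≤ x ^ θ / θ := by
    rcases Nat.eq_zero_or_pos n with h | h
    · rw [h, Nat.cast_zero, Real.log_zero]; positivity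
    · have hn0 : (0 : ℝ) < n := by exact_mod_cast h
      calc Real.log n ≤ Real.log x := Real.log_le_log hn0 hnx
        _ ≤ x ^ θ / θ := Real.log_le_rpow_div (by linarith) hθ
  calc 1 + Real.log n ≤ x ^ θ + x ^ θ / θ := by linarith
    _ = (1 + 1 / θ) * x ^ θ := by ring

/-- **The box sum of `|B(l,r)|²` in terms of `P = CDKHN`** (all divisor functions and the logarithm
absorbed into `P^{6δ}`):
`√(∑ |B|²) ≤ √(3C_δ³(2A)^δ c₂) · P^{3δ} · (H²(HK+N) ∑ ϱ(n) b_n⁴)^{1/2}`. [cite: BombieriFriedlanderIwaniecActa1986, §9 (9.18) p. 231] -/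
theorem sqrt_boxsumB_le {A m K₀ H₀ N₀ : ℕ} (hA : 1 ≤ A) (hK₀ : 1 ≤ K₀) (hH₀ : 1 ≤ H₀)
    {b : ℕ → ℝ} {β : ℕ → ℕ → ℂ} (hβ : ∀ h n, ‖β h n‖ ≤ |b n|)
    {Cδ δ c₂ : ℝ} (hCδ : 1 ≤ Cδ) (hδ : 0 < δ) (hτ : ∀ n : ℕ, (#n.divisors : ℝ) ≤ Cδ * (n : ℝ) ^ δ)
    {C D K H N : ℝ} (hC : 1 ≤ C) (hD : 1 ≤ D) (hK : 1 ≤ K) (hH : 1 ≤ H) (hN : 1 ≤ N)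
    (hK₀K : (K₀ : ℝ) ≤ K) (hH₀H : (H₀ : ℝ) ≤ H) (hN₀N : (N₀ : ℝ) ≤ N)
    (hlog : 1 + Real.log N₀ ≤ c₂ * (C * D * K * H * N) ^ δ) (hc₂0 : 0 ≤ c₂) {L : ℕ}
    (h2L : ((2 ^ L : ℕ) : ℝ) ≤ 2 * N ^ 2) :
    Real.sqrt (∑ y ∈ Icc 1 (A * K₀ * (H₀ * N₀)) ×ˢ Icc 1 (2 ^ L), ‖BcoefB A m β K₀ H₀ N₀ y‖ ^ 2) ≤
      Real.sqrt (3 * Cδ ^ 3 * (2 * A) ^ δ * c₂) * (C * D * K * H * N) ^ (3 * δ) *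
        (H ^ 2 * (H * K + N) * ∑ n ∈ Icc 1 N₀, (rho n : ℝ) * b n ^ 4) ^ (1 / 2 : ℝ) := by
  obtain ⟨hP1, _, _, hKHNP, hNP⟩ := L6.one_le_P hC hD hK hH hN
  set P := C * D * K * H * N with hP
  have hP0 : 0 < P := by linarith
  have hA' : (1 : ℝ) ≤ A := by exact_mod_cast hA
  have hδ0 := hδ.le
  have hCδ0 : 0 ≤ Cδ := by linarith
  have hN0 : (0 : ℝ) ≤ N := by linarith
  -- the divisor bounds on the box
  set Tn : ℝ := Cδ * ((A : ℝ) * (K * H * N)) ^ δ with hTn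
  set Tr : ℝ := Cδ * (2 * N ^ 2) ^ δ with hTr
  set T : ℝ := Cδ * N ^ δ with hT
  have hNmax : ((A * K₀ * (H₀ * N₀) : ℕ) : ℝ) ≤ (A : ℝ) * (K * H * N) := by
    push_cast
    have : (K₀ : ℝ) * (H₀ * N₀) ≤ K * (H * N) := by gcongr
    calc (A : ℝ) * K₀ * (H₀ * N₀) = A * (K₀ * (H₀ * N₀)) := by ring
      _ ≤ A * (K * (H * N)) := mul_le_mul_of_nonneg_left this (by positivity)
      _ = A * (K * H * N) := by ring
  set Y := Icc 1 (A * K₀ * (H₀ * N₀)) ×ˢ Icc 1 (2 ^ L) with hY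
  have hTn_hyp : ∀ y ∈ Y, (#y.1.divisors : ℝ) ≤ Tn := by
    intro y hy
    rw [Finset.mem_product, Finset.mem_Icc] at hy
    refine (hτ y.1).trans (mul_le_mul_of_nonneg_left (Real.rpow_le_rpow (Nat.cast_nonneg _) ?_ hδ0) hCδ0)
    exact le_trans (by exact_mod_cast hy.1.2) hNmax
  have hTr_hyp : ∀ y ∈ Y, (#y.2.divisors : ℝ) ≤ Tr := by
    intro y hy
    rw [Finset.mem_product, Finset.mem_Icc, Finset.mem_Icc] at hy
    refine (hτ y.2).trans (mul_le_mul_of_nonneg_left (Real.rpow_le_rpow (Nat.cast_nonneg _) ?_ hδ0) hCδ0)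
    exact le_trans (by exact_mod_cast hy.2.2) h2L
  have hY' : ∀ y ∈ Y, y.1 ≠ 0 ∧ y.2 ≠ 0 := by
    intro y hy
    rw [Finset.mem_product, Finset.mem_Icc, Finset.mem_Icc] at hy
    exact ⟨by omega, by omega⟩
  have hT_hyp : ∀ d : ℕ, 1 ≤ d → d ≤ N₀ → (#d.divisors : ℝ) ≤ T := by
    intro d _ hdN
    refine (hτ d).trans (mul_le_mul_of_nonneg_left (Real.rpow_le_rpow (Nat.cast_nonneg _) ?_ hδ0) hCδ0)
    exact le_trans (by exact_mod_cast hdN) hN₀N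
  have hT1 : 1 ≤ T := one_le_mul_of_one_le_of_one_le hCδ (Real.one_le_rpow hN hδ0)
  have hbox := boxsumB_le (A := A) (m := m) hA hK₀ hH₀ hβ Y (by positivity) (by positivity) hT1
    hTn_hyp hTr_hyp hY' hT_hyp
  -- the product of the four small factors
  set S₄ := ∑ n ∈ Icc 1 N₀, (rho n : ℝ) * b n ^ 4 with hS₄
  have hS₄0 : 0 ≤ S₄ := Finset.sum_nonneg fun n _ => mul_nonneg (Nat.cast_nonneg _) (by positivity)
  have hprod : 3 * Tn * Tr * T * (1 + Real.log N₀) ≤ (3 * Cδ ^ 3 * (2 * A) ^ δ * c₂) * P ^ (6 * δ) := by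
    have e1 : ((A : ℝ) * (K * H * N)) ^ δ ≤ (A : ℝ) ^ δ * P ^ δ := by
      rw [← Real.mul_rpow (by positivity) hP0.le]
      exact Real.rpow_le_rpow (by positivity) (mul_le_mul_of_nonneg_left hKHNP (by positivity)) hδ0
    have e2 : (2 * N ^ 2) ^ δ ≤ (2 : ℝ) ^ δ * P ^ (2 * δ) := by
      have : N ^ 2 ≤ P ^ 2 := pow_le_pow_left₀ hN0 hNP 2
      have h2 : (P ^ 2) ^ δ = P ^ (2 * δ) := by
        rw [← Real.rpow_natCast, ← Real.rpow_mul hP0.le]; norm_num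
      rw [← h2, ← Real.mul_rpow (by norm_num) (by positivity)]
      exact Real.rpow_le_rpow (by positivity) (by linarith) hδ0
    have e3 : N ^ δ ≤ P ^ δ := Real.rpow_le_rpow hN0 hNP hδ0
    have hPδ1 : 1 ≤ P ^ δ := Real.one_le_rpow hP1 hδ0
    have e5 : P ^ δ * P ^ (2 * δ) * P ^ δ * P ^ δ ≤ P ^ (6 * δ) := by
      have : P ^ δ * P ^ (2 * δ) * P ^ δ * P ^ δ = P ^ (5 * δ) := by
        rw [← Real.rpow_add hP0, ← Real.rpow_add hP0, ← Real.rpow_add hP0]; ring_nf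
      rw [this]
      exact Real.rpow_le_rpow_of_exponent_le hP1 (by linarith)
    have hA2 : (A : ℝ) ^ δ * (2 : ℝ) ^ δ = (2 * A) ^ δ := by
      rw [mul_comm, ← Real.mul_rpow (by norm_num) (by positivity)]
    calc 3 * Tn * Tr * T * (1 + Real.log N₀)
        ≤ 3 * (Cδ * ((A : ℝ) ^ δ * P ^ δ)) * (Cδ * ((2 : ℝ) ^ δ * P ^ (2 * δ))) * (Cδ * P ^ δ) * (c₂ * P ^ δ) := by
          rw [hTn, hTr, hT]
          have hl0 : 0 ≤ 1 + Real.log N₀ := by have := Real.log_natCast_nonneg N₀; linarith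
          gcongr
      _ = (3 * Cδ ^ 3 * ((A : ℝ) ^ δ * (2 : ℝ) ^ δ) * c₂) * (P ^ δ * P ^ (2 * δ) * P ^ δ * P ^ δ) := by ring
      _ ≤ (3 * Cδ ^ 3 * ((A : ℝ) ^ δ * (2 : ℝ) ^ δ) * c₂) * P ^ (6 * δ) :=
          mul_le_mul_of_nonneg_left e5 (by positivity)
      _ = (3 * Cδ ^ 3 * (2 * A) ^ δ * c₂) * P ^ (6 * δ) := by rw [hA2]
  have hHKN : ((H₀ : ℝ) ^ 2 * (H₀ * K₀ + N₀)) ≤ H ^ 2 * (H * K + N) := by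
    have hH00 : (0 : ℝ) ≤ H₀ := Nat.cast_nonneg _
    have : (H₀ : ℝ) * K₀ + N₀ ≤ H * K + N := by gcongr
    have h2 : (H₀ : ℝ) ^ 2 ≤ H ^ 2 := pow_le_pow_left₀ hH00 hH₀H 2
    exact mul_le_mul h2 this (by positivity) (by positivity)
  have hbox' : ∑ y ∈ Y, ‖BcoefB A m β K₀ H₀ N₀ y‖ ^ 2 ≤
      (3 * Cδ ^ 3 * (2 * A) ^ δ * c₂) * P ^ (6 * δ) * (H ^ 2 * (H * K + N) * S₄) := by
    refine hbox.trans ?_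
    have h0 : 0 ≤ 3 * Tn * Tr * T * (1 + Real.log N₀) := by
      have := Real.log_natCast_nonneg N₀
      have : 0 ≤ 1 + Real.log N₀ := by linarith
      positivity
    calc 3 * Tn * Tr * T * (1 + Real.log ↑N₀) * ((H₀ : ℝ) ^ 2 * (H₀ * K₀ + N₀)) * S₄
        = (3 * Tn * Tr * T * (1 + Real.log ↑N₀)) * (((H₀ : ℝ) ^ 2 * (H₀ * K₀ + N₀)) * S₄) := by ring
      _ ≤ ((3 * Cδ ^ 3 * (2 * A) ^ δ * c₂) * P ^ (6 * δ)) * ((H ^ 2 * (H * K + N)) * S₄) :=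
          mul_le_mul hprod (mul_le_mul_of_nonneg_right hHKN hS₄0) (by positivity) (by positivity)
      _ = _ := by ring
  -- take square roots
  set Tt : ℝ := Real.sqrt (3 * Cδ ^ 3 * (2 * A) ^ δ * c₂) * P ^ (3 * δ) *
    (H ^ 2 * (H * K + N) * S₄) ^ (1 / 2 : ℝ) with hTt
  have hTt0 : 0 ≤ Tt := by positivity
  have hTt2 : Tt ^ 2 = (3 * Cδ ^ 3 * (2 * A) ^ δ * c₂) * P ^ (6 * δ) * (H ^ 2 * (H * K + N) * S₄) := by
    have e1 : (P ^ (3 * δ)) ^ 2 = P ^ (6 * δ) := by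
      rw [← Real.rpow_natCast, ← Real.rpow_mul hP0.le]; ring_nf
    have e2 : ((H ^ 2 * (H * K + N) * S₄) ^ (1 / 2 : ℝ)) ^ 2 = H ^ 2 * (H * K + N) * S₄ := by
      rw [← Real.sqrt_eq_rpow, Real.sq_sqrt (by positivity)]
    calc Tt ^ 2 = (Real.sqrt (3 * Cδ ^ 3 * (2 * A) ^ δ * c₂)) ^ 2 * (P ^ (3 * δ)) ^ 2 *
        ((H ^ 2 * (H * K + N) * S₄) ^ (1 / 2 : ℝ)) ^ 2 := by rw [hTt]; ring
      _ = _ := by rw [Real.sq_sqrt (by positivity), e1, e2]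
  calc Real.sqrt (∑ y ∈ Y, ‖BcoefB A m β K₀ H₀ N₀ y‖ ^ 2)
      ≤ Real.sqrt (Tt ^ 2) := Real.sqrt_le_sqrt (hbox'.trans (le_of_eq hTt2.symm))
    _ = Tt := Real.sqrt_sq hTt0

/-- **The diagonal term of one block** in terms of `P = CDKHN`:
`(5C'/4)(5D'/4) · K₀H₀(1 + log N₀) ∑ τ(n) b_n² ≤ (25/4) c₂ C_δ · CDHK · P^{2δ} ∑ b_n²`. [cite: BombieriFriedlanderIwaniecActa1986, §9 (9.16) p. 230] -/
theorem diag_block_le {K₀ H₀ N₀ : ℕ} (b : ℕ → ℝ) {Cδ δ c₂ : ℝ} (hCδ : 1 ≤ Cδ) (hδ : 0 < δ)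
    (hτ : ∀ n : ℕ, (#n.divisors : ℝ) ≤ Cδ * (n : ℝ) ^ δ)
    {C D K H N C' D' : ℝ} (hC : 1 ≤ C) (hD : 1 ≤ D) (hK : 1 ≤ K) (hH : 1 ≤ H) (hN : 1 ≤ N)
    (hK₀K : (K₀ : ℝ) ≤ K) (hH₀H : (H₀ : ℝ) ≤ H) (hN₀N : (N₀ : ℝ) ≤ N)
    (hlog : 1 + Real.log N₀ ≤ c₂ * (C * D * K * H * N) ^ δ) (hc₂0 : 0 ≤ c₂)
    (hC'0 : 0 ≤ C') (hC' : C' ≤ 2 * C) (hD'0 : 0 ≤ D') (hD' : D' ≤ 2 * D) :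
    ((⌊5 / 4 * C'⌋₊ : ℝ) * ⌊5 / 4 * D'⌋₊) *
        ((K₀ : ℝ) * H₀ * (1 + Real.log N₀) * ∑ n ∈ Icc 1 N₀, (#n.divisors : ℝ) * b n ^ 2) ≤
      25 / 4 * c₂ * Cδ * (C * D * H * K) * ((C * D * K * H * N) ^ δ * (C * D * K * H * N) ^ δ) *
        ∑ n ∈ Icc 1 N₀, b n ^ 2 := by
  obtain ⟨hP1, _, _, _, hNP⟩ := L6.one_le_P hC hD hK hH hN
  set P := C * D * K * H * N with hP
  have hP0 : 0 < P := by linarith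
  have hδ0 := hδ.le
  have hCδ0 : 0 ≤ Cδ := by linarith
  have hN0 : (0 : ℝ) ≤ N := by linarith
  have hlog0 : 0 ≤ 1 + Real.log N₀ := by have := Real.log_natCast_nonneg N₀; linarith
  have hS0 : 0 ≤ ∑ n ∈ Icc 1 N₀, b n ^ 2 := Finset.sum_nonneg fun n _ => sq_nonneg _
  -- the floors
  have h1 : (⌊5 / 4 * C'⌋₊ : ℝ) * ⌊5 / 4 * D'⌋₊ ≤ 25 / 4 * (C * D) := by
    have e1 : (⌊5 / 4 * C'⌋₊ : ℝ) ≤ 5 / 4 * (2 * C) := (Nat.floor_le (by positivity)).trans (by linarith)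
    have e2 : (⌊5 / 4 * D'⌋₊ : ℝ) ≤ 5 / 4 * (2 * D) := (Nat.floor_le (by positivity)).trans (by linarith)
    calc (⌊5 / 4 * C'⌋₊ : ℝ) * ⌊5 / 4 * D'⌋₊ ≤ (5 / 4 * (2 * C)) * (5 / 4 * (2 * D)) :=
          mul_le_mul e1 e2 (Nat.cast_nonneg _) (by positivity)
      _ = 25 / 4 * (C * D) := by ring
  -- the weighted second moment
  have h2 : ∑ n ∈ Icc 1 N₀, (#n.divisors : ℝ) * b n ^ 2 ≤ Cδ * P ^ δ * ∑ n ∈ Icc 1 N₀, b n ^ 2 := by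
    rw [Finset.mul_sum]
    refine Finset.sum_le_sum fun n hn => ?_
    have hnN : (n : ℝ) ≤ P := by
      have : (n : ℝ) ≤ N₀ := by exact_mod_cast (Finset.mem_Icc.1 hn).2
      linarith
    have := (hτ n).trans (mul_le_mul_of_nonneg_left (Real.rpow_le_rpow (Nat.cast_nonneg _) hnN hδ0) hCδ0)
    exact mul_le_mul_of_nonneg_right this (sq_nonneg _)
  have h3 : (K₀ : ℝ) * H₀ ≤ K * H := mul_le_mul hK₀K hH₀H (Nat.cast_nonneg _) (by linarith)
  set Sτ := ∑ n ∈ Icc 1 N₀, (#n.divisors : ℝ) * b n ^ 2 with hSτ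
  set S₂ := ∑ n ∈ Icc 1 N₀, b n ^ 2 with hS₂
  have hSτ0 : 0 ≤ Sτ := Finset.sum_nonneg fun n _ => by positivity
  have hF0 : 0 ≤ (⌊5 / 4 * C'⌋₊ : ℝ) * ⌊5 / 4 * D'⌋₊ := by positivity
  have hKH0 : 0 ≤ (K₀ : ℝ) * H₀ := by positivity
  have hPδ0 : 0 ≤ P ^ δ := Real.rpow_nonneg hP0.le δ
  -- multiply the four inequalities
  have m1 : (K₀ : ℝ) * H₀ * (1 + Real.log N₀) ≤ (K * H) * (c₂ * P ^ δ) :=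
    mul_le_mul h3 hlog hlog0 (by positivity)
  have m2 : (K₀ : ℝ) * H₀ * (1 + Real.log N₀) * Sτ ≤ ((K * H) * (c₂ * P ^ δ)) * (Cδ * P ^ δ * S₂) :=
    mul_le_mul m1 h2 hSτ0 (mul_nonneg (by positivity) (mul_nonneg hc₂0 hPδ0))
  have m3 : ((⌊5 / 4 * C'⌋₊ : ℝ) * ⌊5 / 4 * D'⌋₊) * ((K₀ : ℝ) * H₀ * (1 + Real.log N₀) * Sτ) ≤
      (25 / 4 * (C * D)) * (((K * H) * (c₂ * P ^ δ)) * (Cδ * P ^ δ * S₂)) :=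
    mul_le_mul h1 m2 (mul_nonneg (mul_nonneg hKH0 hlog0) hSτ0) (by positivity)
  refine m3.trans (le_of_eq ?_)
  ring

/-! ### Assembly: Lemma 7 for `𝓑_m`, `a = A ≥ 1` -/

set_option maxHeartbeats 2000000 in
-- the final assembly of Lemma 7 (long but elementary bookkeeping)
/-- **BFI Lemma 7 from Lemma 1, for `𝓑_m` and `a = A ≥ 1`** (§9, (9.15), pp. 230–231), uniformly in
the multiplier `m ≥ 1` of the character group:
`𝓑_m ≤ C₇ (CDKHN)^η {CDHK ∑ b_n² + [bracket]^{1/2} (H²(HK+N) ∑ ϱ(n) b_n⁴)^{1/2}}` for all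
coefficients `|β(h, n)| ≤ |b_n|`, the constant `C₇` depending on `η`, `A` and the constant of
Lemma 1 only. [cite: BombieriFriedlanderIwaniecActa1986, §9 Lemma 7 p. 230] -/
theorem dispBm_le_pos (hLB : Lemma1BoundFor plateau2 (5 / 4)) {A : ℕ} (hA : 1 ≤ A) {η : ℝ}
    (hη : 0 < η) :
    ∃ C₇ : ℝ, ∀ m : ℕ, 0 < m → ∀ C D K H N : ℝ, 1 ≤ C → 1 ≤ D → 1 ≤ K → 1 ≤ H → 1 ≤ N →
      ∀ (b : ℕ → ℝ) (β : ℕ → ℕ → ℂ), (∀ h n, ‖β h n‖ ≤ |b n|) →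
        dispBm (A : ℤ) m C D K H N β ≤
          C₇ * ((C * D * K * H * N) ^ η * (C * D * H * K * ∑ n ∈ Icc 1 ⌊N⌋₊, b n ^ 2 +
            (bracket7 C D K H N) ^ (1 / 2 : ℝ) *
              (H ^ 2 * (H * K + N) * ∑ n ∈ Icc 1 ⌊N⌋₊, (rho n : ℝ) * b n ^ 4) ^ (1 / 2 : ℝ))) := by
  -- constants
  set δ : ℝ := η / 10 with hδ
  have hδ0 : 0 < δ := by positivity
  obtain ⟨K', hK'⟩ := hLB δ hδ0
  set K₁ : ℝ := max K' 0 with hK₁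
  have hK₁0 : 0 ≤ K₁ := le_max_right _ _
  have hK₁b : ∀ C' D' N R S : ℝ, 1 ≤ C' → 1 ≤ D' → 1 ≤ N → 1 / 2 ≤ R → 1 / 2 ≤ S →
      ∀ B : ℕ → ℕ → ℕ → ℂ,
        ‖dispK (fun c d => plateau2 (c / C') (d / D')) ⌊5 / 4 * C'⌋₊ ⌊5 / 4 * D'⌋₊ ⌊N⌋₊ R S B‖ ≤
          K₁ * (C' * D' * N * R * S) ^ δ * lemma1I C' D' N R S * lemma1Norm ⌊N⌋₊ R S B := by
    intro C' D' N R S h1 h2 h3 h4 h5 B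
    refine (hK' C' D' N R S h1 h2 h3 h4 h5 B).trans ?_
    have hx : 0 ≤ (C' * D' * N * R * S) ^ δ * lemma1I C' D' N R S * lemma1Norm ⌊N⌋₊ R S B := by
      have : 0 ≤ lemma1I C' D' N R S := Real.sqrt_nonneg _
      have : 0 ≤ lemma1Norm ⌊N⌋₊ R S B := Real.sqrt_nonneg _
      have : 0 ≤ (C' * D' * N * R * S) ^ δ := Real.rpow_nonneg (by positivity) _
      positivity
    calc K' * (C' * D' * N * R * S) ^ δ * lemma1I C' D' N R S * lemma1Norm ⌊N⌋₊ R S B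
        = K' * ((C' * D' * N * R * S) ^ δ * lemma1I C' D' N R S * lemma1Norm ⌊N⌋₊ R S B) := by ring
      _ ≤ K₁ * ((C' * D' * N * R * S) ^ δ * lemma1I C' D' N R S * lemma1Norm ⌊N⌋₊ R S B) :=
          mul_le_mul_of_nonneg_right (le_max_left _ _) hx
      _ = _ := by ring
  obtain ⟨Cδ, hCδ1, hτ⟩ := exists_card_divisors_le_mul_rpow' hδ0
  have hlog2 : 0 < Real.log 2 := Real.log_pos one_lt_two
  set c₁ : ℝ := 1 / (δ * Real.log 2) + 2 with hc₁
  have hc₁0 : 0 ≤ c₁ := by positivity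
  set c₂ : ℝ := 1 + 1 / δ with hc₂
  have hc₂0 : 0 ≤ c₂ := by positivity
  have hA' : (1 : ℝ) ≤ (A : ℝ) := by exact_mod_cast hA
  set V₁ : ℝ := K₁ * (4 * (A : ℝ)) ^ δ * Real.sqrt (16 * A) *
    Real.sqrt (3 * Cδ ^ 3 * (2 * (A : ℝ)) ^ δ * c₂) with hV₁
  have hV₁0 : 0 ≤ V₁ := by positivity
  refine ⟨c₁ ^ 2 * (25 / 4 * c₂ * Cδ) + 2 * c₁ ^ 3 * V₁, ?_⟩
  intro m hm C D K H N hC hD hK hH hN b β hβ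
  obtain ⟨hP1, hCP, hDP, hKHNP, hNP⟩ := L6.one_le_P hC hD hK hH hN
  have hP0 : 0 < C * D * K * H * N := by linarith
  -- the natural-number parameters
  have hK₀1 : 1 ≤ ⌊K⌋₊ := Nat.le_floor (by exact_mod_cast hK)
  have hH₀1 : 1 ≤ ⌊H⌋₊ := Nat.le_floor (by exact_mod_cast hH)
  have hN₀1 : 1 ≤ ⌊N⌋₊ := Nat.le_floor (by exact_mod_cast hN)
  have hC₀1 : 1 ≤ ⌊C⌋₊ := Nat.le_floor (by exact_mod_cast hC)
  have hD₀1 : 1 ≤ ⌊D⌋₊ := Nat.le_floor (by exact_mod_cast hD)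
  have hK₀le : (⌊K⌋₊ : ℝ) ≤ K := Nat.floor_le (by linarith)
  have hH₀le : (⌊H⌋₊ : ℝ) ≤ H := Nat.floor_le (by linarith)
  have hN₀le : (⌊N⌋₊ : ℝ) ≤ N := Nat.floor_le (by linarith)
  have hC₀le : (⌊C⌋₊ : ℝ) ≤ C := Nat.floor_le (by linarith)
  have hD₀le : (⌊D⌋₊ : ℝ) ≤ D := Nat.floor_le (by linarith)
  set L := Nat.log 2 (⌊N⌋₊ * ⌊N⌋₊) + 1 with hL
  have hNN1 : 1 ≤ ⌊N⌋₊ * ⌊N⌋₊ := by nlinarith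
  have hNL : ⌊N⌋₊ * ⌊N⌋₊ ≤ 2 ^ L := (Nat.lt_pow_succ_log_self one_lt_two _).le
  have hNNle : ((⌊N⌋₊ * ⌊N⌋₊ : ℕ) : ℝ) ≤ N ^ 2 := by
    push_cast
    nlinarith [Nat.cast_nonneg (α := ℝ) ⌊N⌋₊]
  have h2L : ((2 ^ L : ℕ) : ℝ) ≤ 2 * N ^ 2 := by
    have h1 : 2 ^ L ≤ 2 * (⌊N⌋₊ * ⌊N⌋₊) := by
      rw [hL, pow_succ']
      exact Nat.mul_le_mul_left 2 (Nat.pow_log_le_self 2 (by omega))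
    calc ((2 ^ L : ℕ) : ℝ) ≤ ((2 * (⌊N⌋₊ * ⌊N⌋₊) : ℕ) : ℝ) := by exact_mod_cast h1
      _ = 2 * ((⌊N⌋₊ * ⌊N⌋₊ : ℕ) : ℝ) := by push_cast; ring
      _ ≤ 2 * N ^ 2 := by linarith
  have hlogN : 1 + Real.log (⌊N⌋₊ : ℝ) ≤ c₂ * (C * D * K * H * N) ^ δ :=
    one_add_log_le_rpow hP1 (hN₀le.trans hNP) hδ0
  -- abbreviations for the target pieces
  set S₂ := ∑ n ∈ Icc 1 ⌊N⌋₊, b n ^ 2 with hS₂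
  have hS₂0 : 0 ≤ S₂ := Finset.sum_nonneg fun n _ => sq_nonneg _
  set W := (H ^ 2 * (H * K + N) * ∑ n ∈ Icc 1 ⌊N⌋₊, (rho n : ℝ) * b n ^ 4) ^ (1 / 2 : ℝ) with hWdef
  have hW0 : 0 ≤ W := Real.rpow_nonneg (mul_nonneg (by positivity)
    (Finset.sum_nonneg fun n _ => mul_nonneg (Nat.cast_nonneg _) (by positivity))) _
  set Br := (bracket7 C D K H N) ^ (1 / 2 : ℝ) with hBrdef
  have hBr0 : 0 ≤ Br :=
    Real.rpow_nonneg (bracket7_nonneg (by linarith) (by linarith) (by linarith) (by linarith) (by linarith)) _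
  have hPδ1 : 1 ≤ (C * D * K * H * N) ^ δ := Real.one_le_rpow hP1 hδ0.le
  set X := C * D * H * K with hX
  have hX0 : 0 ≤ X := by rw [hX]; positivity
  -- the uniform block bound
  have hblock : ∀ i ∈ Finset.range (Nat.log 2 ⌊C⌋₊ + 1 + 1), ∀ j ∈ Finset.range (Nat.log 2 ⌊D⌋₊ + 1 + 1),
      blockB (A : ℤ) m (fun c d => plateau2 (c / (2 : ℝ) ^ i) (d / (2 : ℝ) ^ j))
        ⌊5 / 4 * (2 : ℝ) ^ i⌋₊ ⌊5 / 4 * (2 : ℝ) ^ j⌋₊ ⌊K⌋₊ ⌊H⌋₊ ⌊N⌋₊ β ≤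
        25 / 4 * c₂ * Cδ * X * ((C * D * K * H * N) ^ δ * (C * D * K * H * N) ^ δ) * S₂ +
          2 * (((L + 1 : ℕ) : ℝ) * (V₁ * ((C * D * K * H * N) ^ (3 * δ) * (C * D * K * H * N) ^ (3 * δ)) *
            Br * W)) := by
    intro i hi j hj
    have hi' : (2 : ℝ) ^ i ≤ 2 * C := L6.two_pow_le_of_mem_range hC hi
    have hj' : (2 : ℝ) ^ j ≤ 2 * D := L6.two_pow_le_of_mem_range hD hj
    have h1i : (1 : ℝ) ≤ (2 : ℝ) ^ i := one_le_pow₀ (by norm_num)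
    have h1j : (1 : ℝ) ≤ (2 : ℝ) ^ j := one_le_pow₀ (by norm_num)
    have hb := blockB_le_of_K1 hK₁0 hK₁b hA hm hK₀1 hH₀1 hN₀1 h1i h1j hβ hNL
    refine hb.trans (add_le_add ?_ (mul_le_mul_of_nonneg_left ?_ zero_le_two))
    · exact diag_block_le b hCδ1 hδ0 hτ hC hD hK hH hN hK₀le hH₀le hN₀le hlogN hc₂0 (by positivity) hi'
        (by positivity) hj'
    · have hNk0 : (0 : ℝ) ≤ ((A * ⌊K⌋₊ * (⌊H⌋₊ * ⌊N⌋₊) : ℕ) : ℝ) := Nat.cast_nonneg _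
      have hNk : ((A * ⌊K⌋₊ * (⌊H⌋₊ * ⌊N⌋₊) : ℕ) : ℝ) ≤ (A : ℝ) * (K * H * N) := by
        push_cast
        have : (⌊K⌋₊ : ℝ) * (⌊H⌋₊ * ⌊N⌋₊) ≤ K * (H * N) := by gcongr
        calc (A : ℝ) * ⌊K⌋₊ * (⌊H⌋₊ * ⌊N⌋₊) = A * (⌊K⌋₊ * (⌊H⌋₊ * ⌊N⌋₊)) := by ring
          _ ≤ A * (K * (H * N)) := mul_le_mul_of_nonneg_left this (by positivity)
          _ = A * (K * H * N) := by ring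
      have hl : ∀ l ∈ Finset.range (L + 1),
          K₁ * ((2 : ℝ) ^ i * (2 : ℝ) ^ j * ((A * ⌊K⌋₊ * (⌊H⌋₊ * ⌊N⌋₊) : ℕ) : ℝ) * ((2 : ℝ) ^ l / 2) * (1 / 2)) ^ δ *
            lemma1I ((2 : ℝ) ^ i) ((2 : ℝ) ^ j) ((A * ⌊K⌋₊ * (⌊H⌋₊ * ⌊N⌋₊) : ℕ) : ℝ) ((2 : ℝ) ^ l / 2) (1 / 2) *
            Real.sqrt (∑ y ∈ Icc 1 (A * ⌊K⌋₊ * (⌊H⌋₊ * ⌊N⌋₊)) ×ˢ Icc 1 (2 ^ L),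
              ‖BcoefB A m β ⌊K⌋₊ ⌊H⌋₊ ⌊N⌋₊ y‖ ^ 2) ≤
          V₁ * ((C * D * K * H * N) ^ (3 * δ) * (C * D * K * H * N) ^ (3 * δ)) * Br * W := by
        intro l hl
        have hlL : l ≤ L := Nat.lt_succ_iff.1 (Finset.mem_range.1 hl)
        have hR0 : (0 : ℝ) ≤ (2 : ℝ) ^ l / 2 := by positivity
        have hR : (2 : ℝ) ^ l / 2 ≤ 2 * N ^ 2 := by
          have h1 : ((2 ^ l : ℕ) : ℝ) ≤ ((2 ^ L : ℕ) : ℝ) := by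
            exact_mod_cast Nat.pow_le_pow_right (by norm_num) hlL
          push_cast at h1 h2L
          have : (0 : ℝ) ≤ N ^ 2 := sq_nonneg _
          linarith
        have e1 := eps_factor_le7 hA' hC hD hK hH hN (by positivity) hi' (by positivity) hj'
          hNk0 hNk hR0 hR hδ0.le
        have e2 := lemma1I_le7 hA' hC hD hK hH hN (by positivity) hi' (by positivity) hj'
          hNk0 hNk hR0 hR
        have e3 := sqrt_boxsumB_le (m := m) hA hK₀1 hH₀1 hβ hCδ1 hδ0 hτ hC hD hK hH hN hK₀le hH₀le hN₀le
          hlogN hc₂0 h2L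
        have hI0 : 0 ≤ lemma1I ((2 : ℝ) ^ i) ((2 : ℝ) ^ j) ((A * ⌊K⌋₊ * (⌊H⌋₊ * ⌊N⌋₊) : ℕ) : ℝ)
            ((2 : ℝ) ^ l / 2) (1 / 2) := Real.sqrt_nonneg _
        calc K₁ * ((2 : ℝ) ^ i * (2 : ℝ) ^ j * ((A * ⌊K⌋₊ * (⌊H⌋₊ * ⌊N⌋₊) : ℕ) : ℝ) * ((2 : ℝ) ^ l / 2) * (1 / 2)) ^ δ *
              lemma1I ((2 : ℝ) ^ i) ((2 : ℝ) ^ j) ((A * ⌊K⌋₊ * (⌊H⌋₊ * ⌊N⌋₊) : ℕ) : ℝ) ((2 : ℝ) ^ l / 2) (1 / 2) *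
              Real.sqrt (∑ y ∈ Icc 1 (A * ⌊K⌋₊ * (⌊H⌋₊ * ⌊N⌋₊)) ×ˢ Icc 1 (2 ^ L),
                ‖BcoefB A m β ⌊K⌋₊ ⌊H⌋₊ ⌊N⌋₊ y‖ ^ 2)
            ≤ K₁ * ((4 * (A : ℝ)) ^ δ * (C * D * K * H * N) ^ (3 * δ)) *
              (Real.sqrt (16 * A) * Br) *
              (Real.sqrt (3 * Cδ ^ 3 * (2 * A) ^ δ * c₂) * (C * D * K * H * N) ^ (3 * δ) * W) := by
              gcongr
          _ = V₁ * ((C * D * K * H * N) ^ (3 * δ) * (C * D * K * H * N) ^ (3 * δ)) * Br * W := by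
              rw [hV₁]; ring
      calc ∑ l ∈ Finset.range (L + 1),
            K₁ * ((2 : ℝ) ^ i * (2 : ℝ) ^ j * ((A * ⌊K⌋₊ * (⌊H⌋₊ * ⌊N⌋₊) : ℕ) : ℝ) * ((2 : ℝ) ^ l / 2) * (1 / 2)) ^ δ *
              lemma1I ((2 : ℝ) ^ i) ((2 : ℝ) ^ j) ((A * ⌊K⌋₊ * (⌊H⌋₊ * ⌊N⌋₊) : ℕ) : ℝ) ((2 : ℝ) ^ l / 2) (1 / 2) *
              Real.sqrt (∑ y ∈ Icc 1 (A * ⌊K⌋₊ * (⌊H⌋₊ * ⌊N⌋₊)) ×ˢ Icc 1 (2 ^ L),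
                ‖BcoefB A m β ⌊K⌋₊ ⌊H⌋₊ ⌊N⌋₊ y‖ ^ 2)
          ≤ ∑ l ∈ Finset.range (L + 1),
              V₁ * ((C * D * K * H * N) ^ (3 * δ) * (C * D * K * H * N) ^ (3 * δ)) * Br * W :=
            Finset.sum_le_sum hl
        _ = _ := by rw [Finset.sum_const, Finset.card_range, nsmul_eq_mul]
  -- sum over the blocks
  have hB1 := dispBm_le_sum_blockB (A : ℤ) m C D K H N β
  set U : ℝ := 25 / 4 * c₂ * Cδ * X * ((C * D * K * H * N) ^ δ * (C * D * K * H * N) ^ δ) * S₂ +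
    2 * (((L + 1 : ℕ) : ℝ) * (V₁ * ((C * D * K * H * N) ^ (3 * δ) * (C * D * K * H * N) ^ (3 * δ)) *
      Br * W)) with hU
  have hB2 : dispBm (A : ℤ) m C D K H N β ≤
      ((Nat.log 2 ⌊C⌋₊ + 1 + 1 : ℕ) : ℝ) * (((Nat.log 2 ⌊D⌋₊ + 1 + 1 : ℕ) : ℝ) * U) := by
    refine hB1.trans ?_
    calc ∑ i ∈ Finset.range (Nat.log 2 ⌊C⌋₊ + 1 + 1), ∑ j ∈ Finset.range (Nat.log 2 ⌊D⌋₊ + 1 + 1),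
          blockB (A : ℤ) m (fun c d => plateau2 (c / (2 : ℝ) ^ i) (d / (2 : ℝ) ^ j))
            ⌊5 / 4 * (2 : ℝ) ^ i⌋₊ ⌊5 / 4 * (2 : ℝ) ^ j⌋₊ ⌊K⌋₊ ⌊H⌋₊ ⌊N⌋₊ β
        ≤ ∑ i ∈ Finset.range (Nat.log 2 ⌊C⌋₊ + 1 + 1), ∑ j ∈ Finset.range (Nat.log 2 ⌊D⌋₊ + 1 + 1), U :=
          Finset.sum_le_sum fun i hi => Finset.sum_le_sum fun j hj => hblock i hi j hj
      _ = _ := by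
          rw [Finset.sum_const, Finset.card_range, nsmul_eq_mul, Finset.sum_const, Finset.card_range,
            nsmul_eq_mul]
  -- the counting factors
  have hcC : ((Nat.log 2 ⌊C⌋₊ + 1 + 1 : ℕ) : ℝ) ≤ c₁ * (C * D * K * H * N) ^ δ := by
    have h := L6.natLog_two_add_two_le hC₀1 hC₀le hδ0
    push_cast at h ⊢
    refine (by linarith : (Nat.log 2 ⌊C⌋₊ : ℝ) + 1 + 1 ≤ (1 / (δ * Real.log 2) + 2) * C ^ δ).trans ?_
    exact mul_le_mul_of_nonneg_left (Real.rpow_le_rpow (by linarith) hCP hδ0.le) hc₁0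
  have hcD : ((Nat.log 2 ⌊D⌋₊ + 1 + 1 : ℕ) : ℝ) ≤ c₁ * (C * D * K * H * N) ^ δ := by
    have h := L6.natLog_two_add_two_le hD₀1 hD₀le hδ0
    push_cast at h ⊢
    refine (by linarith : (Nat.log 2 ⌊D⌋₊ : ℝ) + 1 + 1 ≤ (1 / (δ * Real.log 2) + 2) * D ^ δ).trans ?_
    exact mul_le_mul_of_nonneg_left (Real.rpow_le_rpow (by linarith) hDP hδ0.le) hc₁0
  have hcL : ((L + 1 : ℕ) : ℝ) ≤ c₁ * (C * D * K * H * N) ^ (2 * δ) := by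
    have h := L6.natLog_two_add_two_le (x := N ^ 2) hNN1 hNNle hδ0
    rw [hL]
    push_cast at h ⊢
    refine (by linarith : (Nat.log 2 (⌊N⌋₊ * ⌊N⌋₊) : ℝ) + 1 + 1 ≤ (1 / (δ * Real.log 2) + 2) * (N ^ 2) ^ δ).trans ?_
    have e : (N ^ 2) ^ δ = N ^ (2 * δ) := by
      rw [← Real.rpow_natCast, ← Real.rpow_mul (by linarith)]; norm_num
    rw [e]
    exact mul_le_mul_of_nonneg_left (Real.rpow_le_rpow (by linarith) hNP (by positivity)) hc₁0
  -- powers of `p = P^δ`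
  set p : ℝ := (C * D * K * H * N) ^ δ with hp
  have hp1 : 1 ≤ p := hPδ1
  have hp0 : 0 ≤ p := by linarith
  have hp2 : (C * D * K * H * N) ^ (2 * δ) = p ^ 2 := by
    rw [hp, ← Real.rpow_natCast, ← Real.rpow_mul hP0.le]; ring_nf
  have hp3 : (C * D * K * H * N) ^ (3 * δ) = p ^ 3 := by
    rw [hp, ← Real.rpow_natCast, ← Real.rpow_mul hP0.le]; ring_nf
  have hpη : (C * D * K * H * N) ^ η = p ^ 10 := by
    rw [hp, ← Real.rpow_natCast, ← Real.rpow_mul hP0.le, hδ]; ring_nf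
  rw [hp3] at hU
  rw [hp2] at hcL
  rw [hpη]
  -- `U ≤ (25/4)c₂Cδ X p² S₂ + 2 c₁ p² V₁ p⁶ Br W`
  have hU1 : U ≤ 25 / 4 * c₂ * Cδ * X * (p * p) * S₂ + 2 * (c₁ * p ^ 2 * (V₁ * (p ^ 3 * p ^ 3) * Br * W)) := by
    rw [hU]
    have hx : 0 ≤ V₁ * (p ^ 3 * p ^ 3) * Br * W := by positivity
    nlinarith [mul_le_mul_of_nonneg_right hcL hx]
  have hU0 : 0 ≤ U := by rw [hU]; positivity
  -- `dispBm ≤ (c₁ p)(c₁ p) U`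
  have hB3 : dispBm (A : ℤ) m C D K H N β ≤ (c₁ * p) * ((c₁ * p) * U) := by
    refine hB2.trans ?_
    have h2 : ((Nat.log 2 ⌊D⌋₊ + 1 + 1 : ℕ) : ℝ) * U ≤ (c₁ * p) * U := mul_le_mul_of_nonneg_right hcD hU0
    calc ((Nat.log 2 ⌊C⌋₊ + 1 + 1 : ℕ) : ℝ) * (((Nat.log 2 ⌊D⌋₊ + 1 + 1 : ℕ) : ℝ) * U)
        ≤ ((Nat.log 2 ⌊C⌋₊ + 1 + 1 : ℕ) : ℝ) * ((c₁ * p) * U) :=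
          mul_le_mul_of_nonneg_left h2 (Nat.cast_nonneg _)
      _ ≤ (c₁ * p) * ((c₁ * p) * U) := mul_le_mul_of_nonneg_right hcC (by positivity)
  refine hB3.trans ?_
  -- polynomial bookkeeping in `p ≥ 1`
  have hp4le : p ^ 4 ≤ p ^ 10 := pow_le_pow_right₀ hp1 (by norm_num)
  have hCδ0 : 0 ≤ Cδ := by linarith
  have hBW : 0 ≤ Br * W := mul_nonneg hBr0 hW0
  have hXS : 0 ≤ X * S₂ := mul_nonneg hX0 hS₂0
  calc (c₁ * p) * ((c₁ * p) * U)
      ≤ (c₁ * p) * ((c₁ * p) * (25 / 4 * c₂ * Cδ * X * (p * p) * S₂ +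
          2 * (c₁ * p ^ 2 * (V₁ * (p ^ 3 * p ^ 3) * Br * W)))) := by
        gcongr
    _ = c₁ ^ 2 * (25 / 4 * c₂ * Cδ) * (p ^ 4 * (X * S₂)) + 2 * c₁ ^ 3 * V₁ * (p ^ 10 * (Br * W)) := by ring
    _ ≤ c₁ ^ 2 * (25 / 4 * c₂ * Cδ) * (p ^ 10 * (X * S₂)) + 2 * c₁ ^ 3 * V₁ * (p ^ 10 * (Br * W)) := by
        gcongr
    _ ≤ (c₁ ^ 2 * (25 / 4 * c₂ * Cδ) + 2 * c₁ ^ 3 * V₁) * (p ^ 10 * (X * S₂)) +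
          (c₁ ^ 2 * (25 / 4 * c₂ * Cδ) + 2 * c₁ ^ 3 * V₁) * (p ^ 10 * (Br * W)) := by
        have h1 : 0 ≤ 2 * c₁ ^ 3 * V₁ * (p ^ 10 * (X * S₂)) := by positivity
        have h2 : 0 ≤ c₁ ^ 2 * (25 / 4 * c₂ * Cδ) * (p ^ 10 * (Br * W)) := by positivity
        nlinarith
    _ = (c₁ ^ 2 * (25 / 4 * c₂ * Cδ) + 2 * c₁ ^ 3 * V₁) * (p ^ 10 * (X * S₂ + Br * W)) := by ring

/-! ### The sign of `a` -/

/-- `χ⁻¹(x) = conj χ(x)` for a Dirichlet character with values in `ℂ` (both sides vanish at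
non-units). [folklore] -/
theorem inv_apply_eq_conj {q : ℕ} [NeZero q] (χ : DirichletCharacter ℂ q) (x : ZMod q) :
    χ⁻¹ x = conj (χ x) := by
  by_cases hu : IsUnit x
  · rw [MulChar.inv_apply_eq_inv']
    obtain ⟨u, rfl⟩ := hu
    exact Complex.inv_eq_conj (χ.unit_norm_eq_one u)
  · rw [MulChar.map_nonunit _ hu, MulChar.map_nonunit _ hu, map_zero]

/-- **`bInner(−a; β, χ) = conj bInner(a; β̄, χ⁻¹)`** (the residues `((−a)x mod c)` and `((a)x mod c)`
add up to `0 mod c`). [folklore] -/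
theorem bInner_neg (a : ℤ) {m : ℕ} (H N : ℝ) (β : ℕ → ℕ → ℂ) {c : ℕ} (hc : 0 < c) (d k : ℕ)
    [NeZero (m * k)] (χ : DirichletCharacter ℂ (m * k)) :
    bInner (-a) m H N β c d k χ = conj (bInner a m H N (fun h n => conj (β h n)) c d k χ⁻¹) := by
  unfold bInner klNum
  rw [map_sum]
  refine Finset.sum_congr rfl fun h _ => ?_
  rw [map_sum]
  refine Finset.sum_congr rfl fun n _ => ?_
  rw [map_mul, map_mul, Complex.conj_conj, inv_apply_eq_conj, Complex.conj_conj]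
  congr 1
  exact L6.e_val_neg hc a _ h k

/-- **`𝓑_m(−a; β) = 𝓑_m(a; β̄)`**: Lemma 7 for `a < 0` follows from the case `a > 0`. [folklore] -/
theorem dispBm_neg (a : ℤ) {m : ℕ} (hm : 0 < m) (C D K H N : ℝ) (β : ℕ → ℕ → ℂ) :
    dispBm (-a) m C D K H N β = dispBm a m C D K H N (fun h n => conj (β h n)) := by
  unfold dispBm
  refine Finset.sum_congr rfl fun c hc => Finset.sum_congr rfl fun d _ =>
    Finset.sum_congr rfl fun k hk => ?_
  have hc0 : 0 < c := (Finset.mem_Icc.1 hc).1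
  have hk0 : 0 < k := (Finset.mem_Icc.1 hk).1
  haveI : NeZero (m * k) := ⟨(Nat.mul_pos hm hk0).ne'⟩
  congr 1
  refine Fintype.sum_equiv (Equiv.inv (DirichletCharacter ℂ (m * k))) _ _ fun χ => ?_
  rw [Equiv.inv_apply, bInner_neg a H N β hc0 d k χ, Complex.norm_conj]

/-- **BFI Lemma 7 from Lemma 1, for `𝓑_m` and any `a ≠ 0`** (§9, (9.15), pp. 230–231), with the
bracket of (9.15) spelled out. [cite: BombieriFriedlanderIwaniecActa1986, §9 Lemma 7 p. 230] -/
theorem dispBm_le_of_lemma1 (hLB : Lemma1BoundFor plateau2 (5 / 4)) :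
    ∀ a : ℤ, a ≠ 0 → ∀ η : ℝ, 0 < η → ∃ C₇ : ℝ, ∀ m : ℕ, 0 < m → ∀ C D K H N : ℝ,
      1 ≤ C → 1 ≤ D → 1 ≤ K → 1 ≤ H → 1 ≤ N → ∀ (b : ℕ → ℝ) (β : ℕ → ℕ → ℂ),
        (∀ h n, ‖β h n‖ ≤ |b n|) →
          dispBm a m C D K H N β ≤
            C₇ * ((C * D * K * H * N) ^ η * (C * D * H * K * ∑ n ∈ Icc 1 ⌊N⌋₊, b n ^ 2 +
              (bracket7 C D K H N) ^ (1 / 2 : ℝ) *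
                (H ^ 2 * (H * K + N) * ∑ n ∈ Icc 1 ⌊N⌋₊, (rho n : ℝ) * b n ^ 4) ^ (1 / 2 : ℝ))) := by
  intro a ha η hη
  have hA : 1 ≤ a.natAbs := Int.natAbs_pos.2 ha
  obtain ⟨C₇, hC₇⟩ := dispBm_le_pos hLB hA hη
  refine ⟨C₇, fun m hm C D K H N hC hD hK hH hN b β hβ => ?_⟩
  rcases le_or_gt 0 a with h0 | h0
  · have e : a = (a.natAbs : ℤ) := (Int.natAbs_of_nonneg h0).symm
    rw [e]
    exact hC₇ m hm C D K H N hC hD hK hH hN b β hβ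
  · have e : a = -(a.natAbs : ℤ) := by
      rw [Int.ofNat_natAbs_of_nonpos h0.le]; ring
    rw [e, dispBm_neg _ hm]
    refine hC₇ m hm C D K H N hC hD hK hH hN b (fun h n => conj (β h n)) fun h n => ?_
    rw [Complex.norm_conj]
    exact hβ h n

end L7

/-! ### Lemma 7 for `𝓑_m` in the shape consumed by `BombieriFriedlanderIwaniecTheorem2_of_lemma7` -/

/-- **BFI 1986, Lemma 7 (§9, (9.15), p. 230) from Lemma 1**, for the sum `𝓑_m` of (9.14) with the
characters modulo `mk` (`BFI.dispBm`; `m = 1` is the printed `𝓑`), uniformly in `m ≥ 1`, in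
exactly the shape of the hypothesis `h7` of `BFI.BombieriFriedlanderIwaniecTheorem2_of_lemma7`
(`…Theorem2`): "Let `C, D, H, K, N ≥ 1`, `a ≠ 0` and `ε > 0`. Then, for any complex numbers `β_n`
we have `𝓑(C,D,K,H,N) ≪ (CDKHN)^ε {CDHK ∑|β_n|² + [C(N²+HKN)(C+DN²) + C²DN√(N²+HKN) + D²HKN³]^{1/2}
× [H²(HK+N) ∑_n ϱ(n)|β_n|⁴]^{1/2}}`, where the implied constant may depend on `a` and `ε`".
PROVED from the bound of Lemma 1 for the weight `w ⊗ w` (hypothesis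
`BFI.Lemma1BoundFor BFI.plateau2 (5/4)`, as in `…Lemma6`), following the printed proof: smooth
majorant, squaring out with the orthogonality of the characters, the diagonal `l = 0` ((9.16)),
Lemma 1 for `l ≠ 0` by dyadic blocks in `r = n₁n₂` ((9.17)), and the bound (9.18) for `‖B‖²`.
[cite: BombieriFriedlanderIwaniecActa1986, §9 Lemma 7 pp. 230–231] -/
theorem lemma7_dispBm_of_lemma1 (hLB : Lemma1BoundFor plateau2 (5 / 4)) :
    ∀ a : ℤ, a ≠ 0 → ∀ η : ℝ, 0 < η → ∃ C₇ : ℝ, ∀ m : ℕ, 0 < m → ∀ C D K H N' : ℝ,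
      1 ≤ C → 1 ≤ D → 1 ≤ K → 1 ≤ H → 1 ≤ N' → ∀ (b : ℕ → ℝ) (β' : ℕ → ℕ → ℂ),
        (∀ h n, ‖β' h n‖ ≤ |b n|) →
          dispBm a m C D K H N' β' ≤ C₇ * lemma7Rhs C D K H N' η
            (∑ n ∈ Icc 1 ⌊N'⌋₊, b n ^ 2) (∑ n ∈ Icc 1 ⌊N'⌋₊, (rho n : ℝ) * b n ^ 4) := by
  intro a ha η hη
  obtain ⟨C₇, hC₇⟩ := L7.dispBm_le_of_lemma1 hLB a ha η hη
  refine ⟨C₇, fun m hm C D K H N hC hD hK hH hN b β hβ => ?_⟩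
  rw [L7.lemma7Rhs_eq]
  exact hC₇ m hm C D K H N hC hD hK hH hN b β hβ

/-- **Lemma 7 for `𝓑_m` from Lemma 1 quantified over all smooth weights** (the printed form of
Lemma 1: "Let `g₀(ξ, η)` be a smooth function with compact support in `ℝ⁺ × ℝ⁺` … the constant
implied in `≪` depending at most on `ε` and `g(ξ, η)`"; compact support in `ℝ⁺ × ℝ⁺` is rendered as
support in a box `[a, b]²`, `0 < a ≤ b`, as in `BombieriFriedlanderIwaniecTheorem5_of_lemma1'`).
[cite: BombieriFriedlanderIwaniecActa1986, §2 Lemma 1 p. 210; §9 Lemma 7 p. 230] -/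
theorem lemma7_dispBm_of_lemma1'
    (h1 : ∀ g₀ : ℝ → ℝ → ℝ, ContDiff ℝ ∞ (fun p : ℝ × ℝ => g₀ p.1 p.2) →
      ∀ a b : ℝ, 0 < a → a ≤ b →
        (∀ ξ η : ℝ, ¬ (ξ ∈ Set.Icc a b ∧ η ∈ Set.Icc a b) → g₀ ξ η = 0) →
          Lemma1BoundFor g₀ b) :
    ∀ a : ℤ, a ≠ 0 → ∀ η : ℝ, 0 < η → ∃ C₇ : ℝ, ∀ m : ℕ, 0 < m → ∀ C D K H N' : ℝ,
      1 ≤ C → 1 ≤ D → 1 ≤ K → 1 ≤ H → 1 ≤ N' → ∀ (b : ℕ → ℝ) (β' : ℕ → ℕ → ℂ),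
        (∀ h n, ‖β' h n‖ ≤ |b n|) →
          dispBm a m C D K H N' β' ≤ C₇ * lemma7Rhs C D K H N' η
            (∑ n ∈ Icc 1 ⌊N'⌋₊, b n ^ 2) (∑ n ∈ Icc 1 ⌊N'⌋₊, (rho n : ℝ) * b n ^ 4) :=
  lemma7_dispBm_of_lemma1
    (h1 plateau2 contDiff_plateau2 (1 / 4) (5 / 4) (by norm_num) (by norm_num)
      fun _ _ h => plateau2_eq_zero h)

end BFI

end Literature.NumberTheory.Sieve
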